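import Literature.MathematicalPhysics.QuantumFieldTheory.Balaban1983to89.T4CouplingVariance
import Literature.MathematicalPhysics.QuantumFieldTheory.Balaban1983to89.T4PathwiseCouplingComplex
import Literature.Probability.Moments.EfronSteinProofs

/-!
# T⁴ pure Yang–Mills, NE1′ (O3b/H2) — `T4CouplingIncoherence`: the ONE-STEP INCOHERENCE of the coupling line.
# The accumulated one-step conditional variances of the dressing observable — the ONE NUMBER of `T4CouplingVariance`
# — are bounded, step by step and HISTORY BY HISTORY, by HALF THE SUM OF THE SQUARED SENSITIVITIES of the next
# effective observable to the INDEPENDENT INNOVATIONS of the step (Efron–Stein), never by the square of their sum.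

HONEST FRAMING.  This file is MEASURE THEORY (kernel-checked folklore; every declaration is tagged [folklore]).  It
concerns the finite-volume T⁴ renormalisation-group tower of [Balaban1983to89] only through the DICTIONARY below; it
asserts NO printed statement, proves NO estimate of the programme, and is NOT progress on the Clay Millennium problem
(finite T⁴ only, rung (B)+1 of the cell's ladder; no infinite volume, no mass gap, no reconstruction).  The ONE
external result it uses beyond Mathlib and the lineage (`T4PathwiseCoupling` → `T4CouplingChain` →
`T4CouplingDomination` → `T4CouplingVariance`, `T4PathwiseCouplingComplex`) is the EFRON–STEIN INEQUALITY, a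
PUBLISHED theorem (Efron–Stein 1981; Steele 1986; Boucheron–Bousquet–Lugosi 2004 §2 Thm 5) that is KERNEL-PROVED in
this library (`Literature.Probability.Moments.EfronSteinInequality_holds`); it therefore enters as a proved theorem,
not as a cited or minted hypothesis.  The conditional inputs of node NE1′ (BetaPertH, (B), (B^μ) of the cell)
enter ONLY through the instantiation of the sensitivities `c`, the kernels `d` and the second moments `S` below, by
the consumer; nothing of them is hidden in a definition here.

## Why this file (the step left informal by the record, v1.15 §5 «ONE-STEP FORM», (V7))

`T4CouplingVariance` collapsed the fluctuation half of NE1′ to ONE NUMBER,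
`MI-V:  Σ_{b<K} ∫ oneStepVar κ b φ (x≤b) dμ = ∫ (φ − E_μ[φ ∣ x 0])² dμ ≤ 𝒱`, and recorded as the consumer-side step
«summed incoherently over conditionally independent components (Bienaymé) … not formalised here» the passage from a
per-innovation sensitivity of the next conditional mean to a bound on `oneStepVar`.  The lineage's dead end (v1.14)
is the COHERENT version of that passage: bounding the one-step difference by the SUM `Σᵢ cᵢ` of the sensitivities
gives `oneStepVar ≤ (Σᵢ cᵢ)²`, whose cross terms `|C|²L^{2b}q_b²` are not summable in the depth.  The Efron–Stein
inequality is exactly the incoherent replacement: for a function `g` of INDEPENDENT innovations `ξ = (ξᵢ)`,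
`Var g ≤ ½ Σᵢ E (g(ξ) − g(ξ⁽ⁱ⁾))²` (`ξ⁽ⁱ⁾` = `ξ` with the `i`-th innovation resampled), so that sensitivities
`|g(ξ) − g(ξ⁽ⁱ⁾)| ≤ cᵢ·dᵢ(ξᵢ, ξᵢ')` with `E dᵢ² ≤ Sᵢ` give `Var g ≤ ½ Σᵢ cᵢ² Sᵢ` — squared sensitivities, summed
ONCE.  With `N_b = |C|N₀L^{4b}` felt innovations of squared sensitivity `Λ²θ₁^{2b}` this is `½|C|N₀Λ²σ²·(L⁴θ₁²)^b =
½|C|N₀Λ²σ²·L^{-2b}` (`T4PathwiseCoupling.ne1p_sqRate_lt_one`), summable in `b` uniformly in `K` (§6).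

## Dictionary (continuing `T4CouplingChain` / `T4CouplingVariance`)

* `X b` = the level-`(K−b)` configuration space of the mixed tower read fine-to-coarse from the unit lattice
  (`x 0` = unit-lattice field `V_K`, `x K` = finest field `V_0`); `μ` on `Π b, X b` = the UNDRESSED path law;
  `κ b` = ANY version of its backward one-step conditional kernels (§4: every version realises `μ`); `φ` = the dressing
  observable `W_C(avg^K V_0)` (bounded by `R`, `piLE K`-measurable); `towerMean κ φ (x 0)` = `E_μ[φ ∣ V_K]`.
* INNOVATIONS of step `b` (history `h` = levels `≤ b` frozen): independent variables `ξᵢ ~ πᵢ`, `i ∈ ι` — in the cell's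
  use the fresh small-field fluctuation inserts of the resampled blocks / the component resampling variables of ONE
  ℝ- or T-step given everything coarser — and a measurable map `T h : (Π i, E i) → X (b+1)` producing the next level,
  with `κ b h = (⊗ᵢ πᵢ).map (T h)` (HYPOTHESIS SHAPE `hrep`; on standard Borel carriers such a representation always
  exists abstractly — e.g. one innovation uniform on `[0,1]` — so its CONTENT is entirely in the sensitivities below,
  and exact conditional independence ACROSS blocks, false for the interacting law at finite range, is never assumed:
  the coupling between blocks sits inside `T h`).
* SENSITIVITY of step `b` at history `h` to innovation `i`: `cᵢ(h)·dᵢ(ξᵢ, y)` bounds the change of the level-`(b+1)`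
  effective observable `fiberMean κ (b+1) φ (succGlue b (h, T h ξ))` when `ξᵢ` is replaced by `y` (the printed
  analyticity / localisation radii enter HERE, as Lipschitz constants of the next conditional mean in one innovation,
  weighted by the unit loop's averaging sensitivity `Λθ₁^b` to that block); `Sᵢ ≥ ∫ dᵢ(a,·)² dπᵢ` = a SECOND MOMENT of
  the innovation's size (typical-field quantity; large fields enter through its tail, (B)-currency).

## Contents (all [folklore], kernel-checked, no `sorry`)

§1 `partialTraj_succ_self_apply`: the one-step law `partialTraj κ b (b+1) h` IS the push-forward of `κ b h` under the
   gluing `y ↦ succGlue b (h, y)`; `fiberMean_eq_integral_kernel`, `oneStepVar_eq_integral_kernel`,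
   `oneStepVar_eq_variance`: `oneStepVar κ b φ h = Var_{κ b h}[fiberMean κ (b+1) φ (succGlue b (h, ·))]`.
§2 Efron–Stein in SENSITIVITY form on a finite product law (`integral_sq_sub_integral_le_sum_sensitivity`:
   `∫ (g − ∫g)² ≤ ½ Σᵢ cᵢ² Sᵢ`) and in COUNTING form (`half_sum_sq_mul_le_card`: innovations not felt have `cᵢ = 0`,
   the `#M` felt ones `|cᵢ| ≤ Λ`, `Sᵢ ≤ σ²` ⇒ `≤ ½·#M·Λ²·σ²`).
§3 ONE-STEP INCOHERENCE for the chain (`oneStepVar_le_of_rep`, `oneStepVar_le_card_of_rep`): under `hrep`,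
   `oneStepVar κ b φ h ≤ ½ Σᵢ cᵢ(h)² Sᵢ` resp. `≤ ½·#M(h)·Λ²·σ²`, POINTWISE in the history.
§4 `trajMeasure_eq_of_compProd`: ANY family of Markov kernels disintegrating `μ` level by level realises `μ` as its
   Ionescu–Tulcea measure from the endpoint law (so `hrep` may be imposed on a chosen version).
§5 ENVELOPES, end to end.  (a) `integral_mul_exp_sandwich_of_envelope`: a DETERMINISTIC envelope
   `oneStepVar κ b φ ≤ w b` with `Σ_{b<n} w b ≤ W` gives the TWO-SIDED multiplicative sandwich
   `∫ g₀(x 0)e^{t·towerMean}dμ ≤ ∫ g₀(x 0)e^{tφ}dμ ≤ e^{t²W}·∫ g₀(x 0)e^{t·towerMean}dμ` (`|t|·2R ≤ 1`, `0 ≤ g₀ ≤ Cg`)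
   with NO additive error and NO large-field event — UNIFORMITY in `μ`, `K` and the volume from any sup-envelope;
   (b) `ae_complexWindow_of_envelope`: the same envelope gives the COMPLEX dressing factorisation on `μ`-a.e. fibre of
   the unit-lattice field, `E[e^{tφ} ∣ V_K] = e^{t·E[φ∣V_K]}·e^{Ψ}`, `‖Ψ‖ ≤ 8‖t‖²W` for complex `‖t‖ < 1/(4R)`
   (`T4PathwiseCouplingComplex`), i.e. the fibrewise form the record asked for under «complex t»;
   (c) `integral_sq_sub_towerMean_le_of_majorant` / `integral_mul_exp_le_of_majorant`: an INTEGRATED envelope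
   `Σ_b ∫ W b (x≤b) dμ ≤ 𝒱` of measurable per-history majorants gives MI-V and the additive bounds of
   `T4CouplingVariance` §3; (d) path-law forms of (a)–(c) for an ARBITRARY finite path law (standard Borel carriers).
§6 POWER COUNTING as arithmetic (`half_card_mul_le_geometric`, `sum_le_div_of_le_geometric`,
   `integral_mul_exp_sandwich_of_geometric_envelope`): `#M_b ≤ P·G^b`, `Λ_b ≤ Λ₀θ^b`, `Gθ² < 1` ⇒ envelope
   `½PΛ₀²σ²(Gθ²)^b`, total `≤ ½PΛ₀²σ²/(1 − Gθ²)`; for NE1′ `G = L⁴`, `θ = θ₁ = L^{-3}`, `Gθ² = L^{-2}`.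
§7 (v2) ROBUST INCOHERENCE.  (a) `oneStepVar_le_of_dominated`: a DOMINATED step law `κ b h ≤ M•ρ'` bounds the
   one-step variance by `M·∫ (fiberMean − a)² dρ'` for any constant `a`; (b) `oneStepVar_le_of_dominatedRep`
   (+ `_inner`, `oneStepVar_le_card_of_dominatedRep`): under a DOMINATED PRODUCT REPRESENTATION
   `κ b h ≤ M•(⊗ᵢ πᵢ).map T` (approximate conditional independence of the innovations given the history; the exact
   `hrep` of §3 is the case `M = 1`, `dominated_of_rep`) Efron–Stein gives `oneStepVar ≤ M·½ Σᵢ cᵢ² Sᵢ`;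
   (c) `integral_sum_sq_mul_le_of_graded`: GRADED sensitivities `|c ω i| ≤ C·Θ·κ₁^{#{j : ω ∈ A i j}}` on a felt set
   `M₀` with PRODUCT-DOMINATED grading events (`μ(⋂_{j∈S'} A i j) ≤ μ(Ω)·∏_{j∈S'} ε i j`, `Σ_j ε i j ≤ E`) integrate
   to `≤ #M₀·(CΘ)²·σ²·μ(Ω)·e^{(κ₁²−1)E}` (`T4PathwiseCoupling.integral_pow_card_filter_le_exp`); (d) END-TO-END
   PRIMITIVE FORMS `integral_sq_sub_towerMean_le_dominatedSensitivityBudget` / `…_le_of_graded` /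
   `…_le_of_graded_geometric` (+ `_pathLaw` for an arbitrary path law and kernel version, + the exponential-moment
   form `integral_mul_exp_le_of_graded_geometric`): dominated product representations with slack `M₀`, graded
   sensitivities on felt sets `Mf b` with `#Mf b·Θ_b² ≤ P·r^b` (`0 ≤ r < 1`), innovation second moments `≤ σ²`,
   irregularity rates of total `≤ E` ⇒ `∫ (φ − towerMean)² dμ ≤ M₀·½C²σ²·μ(Ω)·e^{(κ₁²−1)E}·P/(1−r)`, free of the
   depth `n`; for NE1′ `r = L⁴θ₁² = L⁻²`.
§8 (v3) LOCALISED DOMINATION.  (a) `integral_sq_sub_towerMean_le_of_stepBudget(_graded_geometric)`: the §7(d)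
   chain factored through an abstract per-step budget `oneStepVar κ b φ h ≤ M₀·½Σᵢ c b h i²·S b i`; (b)
   `oneStepVar_le_of_marginalDominatedRep`: the step law is the image `κ b h = Q.map T` of an ARBITRARY innovation
   law `Q`, the next effective observable depends only on the innovations of a finite FELT SET `F`, and only the
   `F`-MARGINAL of `Q` is dominated, `Q.map F.restrict ≤ M•(⊗ᵢπᵢ).map F.restrict` ⇒ `oneStepVar ≤ M·½Σᵢ cᵢ²Sᵢ`
   (`map_restrict_le_of_le`: global domination ⇒ marginal domination, not conversely); (c)
   `integral_sq_sub_towerMean_le_of_graded_geometric_marginal` (+ `_pathLaw`): the end-to-end primitive form with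
   the slack `M₀` now the density ratio of the FELT marginals only.
§9 (v4) WEAKLY DEPENDENT INNOVATIONS.  Hypothesis shape `hES`: the innovation law `Q` satisfies the Efron–Stein
   inequality `∫ (G − ∫G dQ)² dQ ≤ C_T·½Σᵢ∫∫(G ξ − G (ξ with ξᵢ := y))² d(qᵢ ξ)(y) dQ(ξ)` for all bounded measurable
   `G`, with single-site RESAMPLING KERNELS `qᵢ` and a TENSORISATION CONSTANT `C_T` (product law: `qᵢ ξ = πᵢ`,
   `C_T = 1`, `efronStein_pi_const`); `oneStepVar_le_of_rep_efronSteinWith`: `κ b h = Q.map T`, sensitivities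
   `|g ξ − g (ξ with ξᵢ := y)| ≤ cᵢ·dᵢ(ξᵢ, y)` with resampling second moments `∫ dᵢ(ξᵢ,·)² d(qᵢ ξ) ≤ Sᵢ` ⇒
   `oneStepVar ≤ C_T·½Σᵢcᵢ²Sᵢ` — no product structure, no density ratio; (b)
   `integral_sq_sub_towerMean_le_of_graded_geometric_efronSteinWith` (+ `_pathLaw`): the end-to-end primitive form
   with slack `C_T`.

## What is and is not achieved (honest flags for the record v1.18)

* UNIFORMITY WITHOUT SMALLNESS.  §5(a)/(b) turn ANY deterministic summable envelope into μ-, K- and volume-uniform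
  two-sided bounds with constant `e^{t²W}`; with the trivial budget `w b = (2R)²` this is true and useless (`W = 4R²K`).
  The content of NE1′ is `W = O(|C|ḡ²)`-SMALLNESS, and a DETERMINISTIC (sup over histories) envelope of that size is
  exactly what the record's (A1⁗)(3) denies in the worst case (the contraction rate of the fibre means degrades
  through irregular coarser levels, `κ^{irr}`); so the smallness target remains the INTEGRATED budget
  MI-ES: `Σ_{b<K} ∫ ½ Σᵢ c_{b,i}(x≤b)² S_{b,i} dμ ≤ 𝒱(ḡ, |C|, L)` (§5(c)), fed by the record's (R1).
* NOT PROVED, NOT CITED, NOT ASSERTED here: the representation `hrep` and the sensitivities `c`, `d`, `S` for the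
  printed kernels (this is where B4–B16 / the large-field apparatus would enter); MI-ES; MI-3/(A2) (β-node); any
  statement about infinite volume.
* (v2) §7 weakens the two idealisations of §3/§5: the EXACT `hrep` becomes a DOMINATED product (print's product
  structure is the FORWARD one of ℝ over components; backward it is the Gibbs–Markov factorisation of the level
  density given the configuration outside the components, exact only up to the non-local small terms of the effective
  action — whence the slack `M`), and the deterministic sensitivity bound becomes a GRADED one (an irregular coarser
  level of the HISTORY costs a factor `κ₁` on the sensitivity, product-dominated in expectation; a crude off-domain
  bound `2B` per felt innovation is NOT summable against `#felt_b ≍ L^{4b}` since the large-field rates decay only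
  superpolynomially in the level).  The primitives (i)–(v) of §7(d) are DISPLAYED HYPOTHESES, matched to print only in
  the record (MI-ES); none of them is proved, cited or asserted here.
* (v3) §8 corrects the currency of the slack: §7's GLOBAL domination `κ b h ≤ M•(⊗ᵢπᵢ).map T` of a Gibbs-tilted
  law costs `M = e^{2u}` with `u` the total size of the tilt, which grows with the volume; only the FELT-MARGINAL
  domination of §8(b) can be volume-free (the felt set of a step is fixed by the loop's tube, `#F ≤ N₀L^{4b}`
  components, and its marginal density ratio is governed by the linking terms touching them).  That this marginal
  ratio is bounded free of the volume and of `K` for the printed kernels is a DISPLAYED HYPOTHESIS (`hdomF`), part of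
  MI-ES (ES-rep) in its robust form; it is not proved, cited or asserted here.
* (v4) §9 names the currency that is free of the SIZE OF THE FELT SET as well: a density ratio against the product
  reference (§7 global, §8 felt-marginal) is `e^{Θ(#F·s)}` for `#F` linking terms of size `s`, and `#F_b ≍ |C|N₀L^{4b}`
  grows with the level; the approximate-tensorisation constant `C_T` of a weakly dependent law is governed by a
  PER-SITE interdependence row sum instead (Dobrushin regime: `C_T = 1/(1−α)`) — a published implication of the
  Dobrushin-uniqueness literature that is NOT formalised, NOT cited as a fact and NOT asserted here: `hES` for the
  printed kernels, with `C_T` free of `K`, of the volume and of the level, is a DISPLAYED HYPOTHESIS (record MI-ES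
  (ES-rep), tensorised form), as are the resampling second moments under `q b h i`.
-/

noncomputable section

open MeasureTheory ProbabilityTheory Finset Preorder Function
open scoped ProbabilityTheory ENNReal

namespace Literature.MathematicalPhysics.QuantumFieldTheory.Balaban1983to89.T4CouplingIncoherence

open MeasureTheory.Filtration
open Literature.MathematicalPhysics.QuantumFieldTheory.Balaban1983to89.T4MeanChannel
open Literature.MathematicalPhysics.QuantumFieldTheory.Balaban1983to89.T4PathwiseCoupling
open Literature.MathematicalPhysics.QuantumFieldTheory.Balaban1983to89.T4PathwiseCouplingComplex
open Literature.MathematicalPhysics.QuantumFieldTheory.Balaban1983to89.T4CouplingChain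
open Literature.MathematicalPhysics.QuantumFieldTheory.Balaban1983to89.T4CouplingDomination
open Literature.MathematicalPhysics.QuantumFieldTheory.Balaban1983to89.T4CouplingVariance
open Literature.Probability.Moments

universe u v

/-! ## §1  The one-step law in kernel form; `oneStepVar` is a variance under ONE draw from `κ b h` -/

section OneStep

variable {X : ℕ → Type*} [∀ n, MeasurableSpace (X n)]
variable {κ : (b : ℕ) → Kernel (Π i : Iic b, X i) (X (b + 1))} [∀ b, IsMarkovKernel (κ b)]

omit [∀ b, IsMarkovKernel (κ b)] in
/-- [folklore] Gluing a fixed history with a variable next level is measurable. -/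
theorem measurable_succGlue_mk (b : ℕ) (h : Π i : Iic b, X i) :
    Measurable (fun y : X (b + 1) => succGlue b (h, y)) :=
  (measurable_succGlue b).comp measurable_prodMk_left

/-- [folklore] **THE ONE-STEP LAW IS THE GLUED FIBRE KERNEL**: `partialTraj κ b (b+1) h = (κ b h).map (succGlue b (h, ·))`
— one draw `y` of level `b+1` from the fibre kernel at the history `h`, glued to `h`. -/
theorem partialTraj_succ_self_apply (b : ℕ) (h : Π i : Iic b, X i) :
    Kernel.partialTraj κ b (b + 1) h = (κ b h).map (fun y => succGlue b (h, y)) := by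
  rw [Kernel.partialTraj_succ_self, Kernel.map_apply _ measurable_IicProdIoc, Kernel.prod_apply, Kernel.id_apply,
    Kernel.map_apply _ (MeasurableEquiv.piSingleton b).measurable, Measure.dirac_prod,
    Measure.map_map measurable_prodMk_left (MeasurableEquiv.piSingleton b).measurable,
    Measure.map_map measurable_IicProdIoc
      (measurable_prodMk_left.comp (MeasurableEquiv.piSingleton b).measurable)]
  rfl

/-- [folklore] Integrals against the one-step law are integrals against the fibre kernel of the glued integrand. -/
theorem integral_partialTraj_succ (b : ℕ) (h : Π i : Iic b, X i) {G : (Π i : Iic (b + 1), X i) → ℝ}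
    (hG : StronglyMeasurable G) :
    ∫ u, G u ∂(Kernel.partialTraj κ b (b + 1) h) = ∫ y, G (succGlue b (h, y)) ∂(κ b h) := by
  rw [partialTraj_succ_self_apply,
    integral_map (measurable_succGlue_mk b h).aemeasurable hG.aestronglyMeasurable]

/-- [folklore] **ONE-STEP RECURSION OF THE FIBRE MEANS, kernel form**:
`fiberMean κ b φ h = ∫ fiberMean κ (b+1) φ (succGlue b (h, y)) d(κ b h)(y)`. -/
theorem fiberMean_eq_integral_kernel (b : ℕ) {φ : (Π n, X n) → ℝ} (hφm : StronglyMeasurable φ) {R : ℝ}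
    (hφR : ∀ x, |φ x| ≤ R) (h : Π i : Iic b, X i) :
    fiberMean κ b φ h = ∫ y, fiberMean κ (b + 1) φ (succGlue b (h, y)) ∂(κ b h) := by
  rw [fiberMean_eq_integral_partialTraj b hφm hφR h,
    integral_partialTraj_succ b h (stronglyMeasurable_fiberMean _ hφm)]

/-- [folklore] **THE ONE-STEP VARIANCE, kernel form**:
`oneStepVar κ b φ h = ∫ (fiberMean κ (b+1) φ (succGlue b (h, y)) − fiberMean κ b φ h)² d(κ b h)(y)`. -/
theorem oneStepVar_eq_integral_kernel (b : ℕ) {φ : (Π n, X n) → ℝ} (hφm : StronglyMeasurable φ)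
    (h : Π i : Iic b, X i) :
    oneStepVar κ b φ h =
      ∫ y, (fiberMean κ (b + 1) φ (succGlue b (h, y)) - fiberMean κ b φ h) ^ 2 ∂(κ b h) := by
  rw [oneStepVar]
  exact integral_partialTraj_succ b h
    (((stronglyMeasurable_fiberMean _ hφm).sub stronglyMeasurable_const).pow 2)

/-- [folklore] **THE ONE-STEP VARIANCE IS A VARIANCE**: `oneStepVar κ b φ h = Var_{κ b h}[y ↦ fiberMean κ (b+1) φ
(succGlue b (h, y))]` — the variance of the next effective observable under ONE draw of the next level. -/
theorem oneStepVar_eq_variance (b : ℕ) {φ : (Π n, X n) → ℝ} (hφm : StronglyMeasurable φ) {R : ℝ}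
    (hφR : ∀ x, |φ x| ≤ R) (h : Π i : Iic b, X i) :
    oneStepVar κ b φ h = Var[fun y => fiberMean κ (b + 1) φ (succGlue b (h, y)); κ b h] := by
  have hGm : Measurable (fun y => fiberMean κ (b + 1) φ (succGlue b (h, y))) :=
    (stronglyMeasurable_fiberMean _ hφm).measurable.comp (measurable_succGlue_mk b h)
  rw [variance_eq_integral hGm.aemeasurable, oneStepVar_eq_integral_kernel b hφm h]
  refine integral_congr_ae (ae_of_all _ fun y => ?_)
  simp only [← fiberMean_eq_integral_kernel b hφm hφR h]

end OneStep

/-! ## §2  Efron–Stein in sensitivity form and in counting form (finite product laws) -/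

section EfronSteinSensitivity

variable {ι : Type u} [Fintype ι] [DecidableEq ι] {E : ι → Type v} [∀ i, MeasurableSpace (E i)]

/-- [folklore] **EFRON–STEIN, integral form** (the library's proved `EfronSteinInequality_holds`, with the variance
written out): for a bounded measurable `g` on a finite product of probability spaces,
`∫ (g − ∫ g)² dΠ ≤ ½ Σᵢ ∫∫ (g x − g (x with xᵢ := y))² dπᵢ(y) dΠ(x)`. -/
theorem integral_sq_sub_integral_le_efronStein (π : (i : ι) → Measure (E i))
    [∀ i, IsProbabilityMeasure (π i)] {g : ((i : ι) → E i) → ℝ} (hg : Measurable g) {B : ℝ}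
    (hB : ∀ x, |g x| ≤ B) :
    ∫ x, (g x - ∫ z, g z ∂Measure.pi π) ^ 2 ∂Measure.pi π ≤
      (1 / 2 : ℝ) * ∑ i, ∫ x, (∫ y, (g x - g (Function.update x i y)) ^ 2 ∂π i) ∂Measure.pi π := by
  have hmem : MemLp g 2 (Measure.pi π) :=
    memLp_of_bounded (a := -B) (b := B) (Filter.Eventually.of_forall fun x => abs_le.1 (hB x))
      hg.aestronglyMeasurable 2
  rw [← variance_eq_integral hg.aemeasurable]
  exact EfronSteinInequality_holds ι E π g hg hmem

/-- [folklore] **EFRON–STEIN, SENSITIVITY FORM.**  If replacing the `i`-th innovation moves `g` by at most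
`cᵢ·dᵢ(xᵢ, y)` and `∫ dᵢ(a, y)² dπᵢ(y) ≤ Sᵢ` for every `a`, then `∫ (g − ∫ g)² dΠ ≤ ½ Σᵢ cᵢ²·Sᵢ` — the SQUARED
sensitivities summed ONCE (incoherently), never `(Σᵢ cᵢ)²`. -/
theorem integral_sq_sub_integral_le_sum_sensitivity (π : (i : ι) → Measure (E i))
    [∀ i, IsProbabilityMeasure (π i)] {g : ((i : ι) → E i) → ℝ} (hg : Measurable g) {B : ℝ}
    (hB : ∀ x, |g x| ≤ B) {c : ι → ℝ} {d : (i : ι) → E i → E i → ℝ}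
    (hdi : ∀ i a, Integrable (fun y => d i a y ^ 2) (π i)) {S : ι → ℝ}
    (hS : ∀ i a, ∫ y, d i a y ^ 2 ∂π i ≤ S i)
    (hc : ∀ i x y, |g x - g (Function.update x i y)| ≤ c i * d i (x i) y) :
    ∫ x, (g x - ∫ z, g z ∂Measure.pi π) ^ 2 ∂Measure.pi π ≤ (1 / 2 : ℝ) * ∑ i, c i ^ 2 * S i := by
  refine (integral_sq_sub_integral_le_efronStein π hg hB).trans
    (mul_le_mul_of_nonneg_left (Finset.sum_le_sum fun i _ => ?_) (by norm_num))
  have hin : ∀ x, ∫ y, (g x - g (Function.update x i y)) ^ 2 ∂π i ≤ c i ^ 2 * S i := fun x => by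
    calc ∫ y, (g x - g (Function.update x i y)) ^ 2 ∂π i ≤ ∫ y, c i ^ 2 * d i (x i) y ^ 2 ∂π i :=
          integral_mono_of_nonneg (Filter.Eventually.of_forall fun y => sq_nonneg _)
            ((hdi i (x i)).const_mul _) (Filter.Eventually.of_forall fun y => by
              have h := hc i x y
              dsimp only
              rw [← sq_abs, ← mul_pow]
              exact pow_le_pow_left₀ (abs_nonneg _) h 2)
      _ = c i ^ 2 * ∫ y, d i (x i) y ^ 2 ∂π i := integral_const_mul _ _
      _ ≤ c i ^ 2 * S i := mul_le_mul_of_nonneg_left (hS i (x i)) (sq_nonneg _)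
  calc ∫ x, ∫ y, (g x - g (Function.update x i y)) ^ 2 ∂π i ∂Measure.pi π
      ≤ ∫ _x, c i ^ 2 * S i ∂Measure.pi π :=
        integral_mono_of_nonneg
          (Filter.Eventually.of_forall fun x => integral_nonneg fun y => sq_nonneg _)
          (integrable_const _) (Filter.Eventually.of_forall hin)
    _ = c i ^ 2 * S i := by rw [integral_const, smul_eq_mul, probReal_univ, one_mul]

omit [Fintype ι] in
/-- [folklore] The inner Efron–Stein integrand `x ↦ ∫ (g x − g (x with xᵢ := y))² dπᵢ(y)` is measurable. -/
theorem stronglyMeasurable_integral_sq_update (π : (i : ι) → Measure (E i)) [∀ i, IsProbabilityMeasure (π i)]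
    {g : ((i : ι) → E i) → ℝ} (hg : Measurable g) (i : ι) :
    StronglyMeasurable (fun x => ∫ y, (g x - g (Function.update x i y)) ^ 2 ∂π i) := by
  have hF : Measurable (fun p : ((i : ι) → E i) × E i => (g p.1 - g (Function.update p.1 i p.2)) ^ 2) :=
    ((hg.comp measurable_fst).sub (hg.comp measurable_update')).pow_const 2
  exact hF.stronglyMeasurable.integral_prod_right'

omit [Fintype ι] in
/-- [folklore] The inner Efron–Stein integrand of a function bounded by `B` is between `0` and `(2B)²`. -/
theorem integral_sq_update_mem (π : (i : ι) → Measure (E i)) [∀ i, IsProbabilityMeasure (π i)]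
    {g : ((i : ι) → E i) → ℝ} {B : ℝ} (hB : ∀ x, |g x| ≤ B) (i : ι) (x : (i : ι) → E i) :
    0 ≤ ∫ y, (g x - g (Function.update x i y)) ^ 2 ∂π i ∧
      ∫ y, (g x - g (Function.update x i y)) ^ 2 ∂π i ≤ (2 * B) ^ 2 := by
  refine ⟨integral_nonneg fun y => sq_nonneg _, ?_⟩
  have hpt : ∀ y, (g x - g (Function.update x i y)) ^ 2 ≤ (2 * B) ^ 2 := fun y => by
    have h1 : |g x - g (Function.update x i y)| ≤ 2 * B :=
      (abs_sub _ _).trans (by linarith [hB x, hB (Function.update x i y)])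
    rw [← sq_abs]
    exact pow_le_pow_left₀ (abs_nonneg _) h1 2
  calc ∫ y, (g x - g (Function.update x i y)) ^ 2 ∂π i ≤ ∫ _y, (2 * B) ^ 2 ∂π i :=
        integral_mono_of_nonneg (Filter.Eventually.of_forall fun y => sq_nonneg _) (integrable_const _)
          (Filter.Eventually.of_forall hpt)
    _ = (2 * B) ^ 2 := by rw [integral_const, smul_eq_mul, probReal_univ, one_mul]

/-- [folklore] **EFRON–STEIN WITH INTEGRATED SENSITIVITIES** (the most flexible interface): if the inner resampling
second moments are dominated, `∫ (g x − g (x with xᵢ := y))² dπᵢ(y) ≤ Vᵢ(x)`, by integrable functions `Vᵢ` of the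
WHOLE innovation configuration (so that atypical configurations of the OTHER innovations may carry larger
sensitivities, paid for by their probability), then `∫ (g − ∫ g)² dΠ ≤ ½ Σᵢ ∫ Vᵢ dΠ`. -/
theorem integral_sq_sub_integral_le_sum_of_inner (π : (i : ι) → Measure (E i))
    [∀ i, IsProbabilityMeasure (π i)] {g : ((i : ι) → E i) → ℝ} (hg : Measurable g) {B : ℝ}
    (hB : ∀ x, |g x| ≤ B) {V : ι → ((i : ι) → E i) → ℝ}
    (hin : ∀ i x, ∫ y, (g x - g (Function.update x i y)) ^ 2 ∂π i ≤ V i x)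
    (hVi : ∀ i, Integrable (V i) (Measure.pi π)) :
    ∫ x, (g x - ∫ z, g z ∂Measure.pi π) ^ 2 ∂Measure.pi π ≤ (1 / 2 : ℝ) * ∑ i, ∫ x, V i x ∂Measure.pi π := by
  refine (integral_sq_sub_integral_le_efronStein π hg hB).trans
    (mul_le_mul_of_nonneg_left (Finset.sum_le_sum fun i _ => ?_) (by norm_num))
  exact integral_mono_of_nonneg (Filter.Eventually.of_forall fun x => integral_nonneg fun y => sq_nonneg _)
    (hVi i) (Filter.Eventually.of_forall (hin i))

/-- [folklore] **COUNTING FORM of the sensitivity budget**: innovations outside a finite set `M` are not felt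
(`cᵢ = 0`), the felt ones have `|cᵢ| ≤ Λ`, and all second moments are `≤ σ²`; then `½ Σᵢ cᵢ² Sᵢ ≤ ½·#M·Λ²·σ²`. -/
theorem half_sum_sq_mul_le_card (M : Finset ι) {c S : ι → ℝ}
    {Λ σsq : ℝ} (hcM : ∀ i ∈ M, |c i| ≤ Λ) (hc0 : ∀ i ∉ M, c i = 0) (hS0 : ∀ i, 0 ≤ S i)
    (hS : ∀ i, S i ≤ σsq) :
    (1 / 2 : ℝ) * ∑ i, c i ^ 2 * S i ≤ (1 / 2 : ℝ) * (M.card * (Λ ^ 2 * σsq)) := by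
  refine mul_le_mul_of_nonneg_left ?_ (by norm_num)
  have hpt : ∀ i, c i ^ 2 * S i ≤ if i ∈ M then Λ ^ 2 * σsq else 0 := by
    intro i
    split_ifs with hi
    · have h1 : c i ^ 2 ≤ Λ ^ 2 := by
        rw [← sq_abs]
        exact pow_le_pow_left₀ (abs_nonneg _) (hcM i hi) 2
      exact mul_le_mul h1 (hS i) (hS0 i) (sq_nonneg _)
    · rw [hc0 i hi]
      simp
  calc ∑ i, c i ^ 2 * S i ≤ ∑ i, (if i ∈ M then Λ ^ 2 * σsq else 0) :=
        Finset.sum_le_sum fun i _ => hpt i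
    _ = ∑ i ∈ M, Λ ^ 2 * σsq := Fintype.sum_ite_mem M _
    _ = M.card * (Λ ^ 2 * σsq) := by rw [Finset.sum_const, nsmul_eq_mul]

end EfronSteinSensitivity

/-! ## §3  ONE-STEP INCOHERENCE for the chain: `oneStepVar ≤ ½ Σᵢ cᵢ² Sᵢ` under a product representation of
the step law -/

section ChainIncoherence

variable {X : ℕ → Type*} [∀ n, MeasurableSpace (X n)]
variable {κ : (b : ℕ) → Kernel (Π i : Iic b, X i) (X (b + 1))} [∀ b, IsMarkovKernel (κ b)]
variable {ι : Type u} [Fintype ι] [DecidableEq ι] {E : ι → Type v} [∀ i, MeasurableSpace (E i)]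

omit [DecidableEq ι] in
/-- [folklore] **THE ONE-STEP VARIANCE ON THE INNOVATION SPACE.**  If the fibre kernel at the history `h` is the image
of a product law under a measurable map `T` (`κ b h = (⊗ᵢ πᵢ).map T`), then `oneStepVar κ b φ h` is the variance, under
the product law, of `ξ ↦ fiberMean κ (b+1) φ (succGlue b (h, T ξ))`. -/
theorem oneStepVar_eq_integral_pi_of_rep (b : ℕ) {φ : (Π n, X n) → ℝ} (hφm : StronglyMeasurable φ) {R : ℝ}
    (hφR : ∀ x, |φ x| ≤ R) (h : Π i : Iic b, X i) (π : (i : ι) → Measure (E i))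
    [∀ i, IsProbabilityMeasure (π i)] {T : ((i : ι) → E i) → X (b + 1)} (hT : Measurable T)
    (hrep : κ b h = (Measure.pi π).map T) :
    oneStepVar κ b φ h = ∫ ξ, (fiberMean κ (b + 1) φ (succGlue b (h, T ξ)) -
        ∫ ζ, fiberMean κ (b + 1) φ (succGlue b (h, T ζ)) ∂Measure.pi π) ^ 2 ∂Measure.pi π := by
  have hGm : StronglyMeasurable (fun y : X (b + 1) => fiberMean κ (b + 1) φ (succGlue b (h, y))) :=
    (stronglyMeasurable_fiberMean _ hφm).comp_measurable (measurable_succGlue_mk b h)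
  have hmean : fiberMean κ b φ h = ∫ ζ, fiberMean κ (b + 1) φ (succGlue b (h, T ζ)) ∂Measure.pi π := by
    rw [fiberMean_eq_integral_kernel b hφm hφR h, hrep, integral_map hT.aemeasurable hGm.aestronglyMeasurable]
  have hG2 : AEStronglyMeasurable
      (fun y : X (b + 1) => (fiberMean κ (b + 1) φ (succGlue b (h, y)) - fiberMean κ b φ h) ^ 2)
      ((Measure.pi π).map T) :=
    ((hGm.sub stronglyMeasurable_const).pow 2).aestronglyMeasurable
  rw [oneStepVar_eq_integral_kernel b hφm h, hrep, integral_map hT.aemeasurable hG2, ← hmean]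

/-- [folklore] **ONE-STEP INCOHERENCE, integrated-sensitivity form.**  Under the product representation
`κ b h = (⊗ᵢ πᵢ).map T`: if the resampling second moment of the next effective observable in innovation `i` is
dominated by an integrable `Vᵢ(ξ)`, then `oneStepVar κ b φ h ≤ ½ Σᵢ ∫ Vᵢ dΠ`. -/
theorem oneStepVar_le_of_rep_inner (b : ℕ) {φ : (Π n, X n) → ℝ} (hφm : StronglyMeasurable φ) {R : ℝ}
    (hφR : ∀ x, |φ x| ≤ R) (h : Π i : Iic b, X i) (π : (i : ι) → Measure (E i))
    [∀ i, IsProbabilityMeasure (π i)] {T : ((i : ι) → E i) → X (b + 1)} (hT : Measurable T)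
    (hrep : κ b h = (Measure.pi π).map T) {V : ι → ((i : ι) → E i) → ℝ}
    (hin : ∀ i ξ, ∫ y, (fiberMean κ (b + 1) φ (succGlue b (h, T ξ)) -
        fiberMean κ (b + 1) φ (succGlue b (h, T (Function.update ξ i y)))) ^ 2 ∂π i ≤ V i ξ)
    (hVi : ∀ i, Integrable (V i) (Measure.pi π)) :
    oneStepVar κ b φ h ≤ (1 / 2 : ℝ) * ∑ i, ∫ ξ, V i ξ ∂Measure.pi π := by
  rw [oneStepVar_eq_integral_pi_of_rep b hφm hφR h π hT hrep]
  have hgm : Measurable (fun ξ => fiberMean κ (b + 1) φ (succGlue b (h, T ξ))) :=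
    (stronglyMeasurable_fiberMean _ hφm).measurable.comp ((measurable_succGlue_mk b h).comp hT)
  exact integral_sq_sub_integral_le_sum_of_inner π hgm (fun ξ => abs_fiberMean_le _ hφm hφR _) hin hVi

/-- [folklore] **ONE-STEP INCOHERENCE.**  Under the product representation `κ b h = (⊗ᵢ πᵢ).map T` of the step law at
the history `h`: if replacing innovation `i` (value `ξᵢ ↦ y`) moves the next effective observable
`fiberMean κ (b+1) φ (succGlue b (h, T ξ))` by at most `cᵢ·dᵢ(ξᵢ, y)`, with `∫ dᵢ(a, ·)² dπᵢ ≤ Sᵢ`, then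
`oneStepVar κ b φ h ≤ ½ Σᵢ cᵢ²·Sᵢ`.  This is the formal «Bienaymé / conditionally independent components» step of the
record: the squared per-innovation sensitivities add, the sensitivities themselves never do. -/
theorem oneStepVar_le_of_rep (b : ℕ) {φ : (Π n, X n) → ℝ} (hφm : StronglyMeasurable φ) {R : ℝ}
    (hφR : ∀ x, |φ x| ≤ R) (h : Π i : Iic b, X i) (π : (i : ι) → Measure (E i))
    [∀ i, IsProbabilityMeasure (π i)] {T : ((i : ι) → E i) → X (b + 1)} (hT : Measurable T)
    (hrep : κ b h = (Measure.pi π).map T) {c : ι → ℝ} {d : (i : ι) → E i → E i → ℝ}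
    (hdi : ∀ i a, Integrable (fun y => d i a y ^ 2) (π i)) {S : ι → ℝ}
    (hS : ∀ i a, ∫ y, d i a y ^ 2 ∂π i ≤ S i)
    (hc : ∀ i ξ y, |fiberMean κ (b + 1) φ (succGlue b (h, T ξ)) -
        fiberMean κ (b + 1) φ (succGlue b (h, T (Function.update ξ i y)))| ≤ c i * d i (ξ i) y) :
    oneStepVar κ b φ h ≤ (1 / 2 : ℝ) * ∑ i, c i ^ 2 * S i := by
  rw [oneStepVar_eq_integral_pi_of_rep b hφm hφR h π hT hrep]
  have hgm : Measurable (fun ξ => fiberMean κ (b + 1) φ (succGlue b (h, T ξ))) :=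
    (stronglyMeasurable_fiberMean _ hφm).measurable.comp ((measurable_succGlue_mk b h).comp hT)
  exact integral_sq_sub_integral_le_sum_sensitivity π hgm (fun ξ => abs_fiberMean_le _ hφm hφR _) hdi hS hc

/-- [folklore] **ONE-STEP INCOHERENCE, counting form.**  Under the product representation: if only the innovations of a
finite set `M` (those FELT by the loop at this step and history) can move the next effective observable, each by at
most `Λ·dᵢ`, and all `Sᵢ ≤ σ²`, then `oneStepVar κ b φ h ≤ ½·#M·Λ²·σ²`.  In the dictionary `#M = #M_b(h)` is the
number of step-`b` blocks whose resampling the loop feels (`≤ |C|N₀L^{4b}` in the worst case), `Λ = Λ_b ≍ θ₁^b` the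
averaging sensitivity, `σ²` a second moment of one block's innovation. -/
theorem oneStepVar_le_card_of_rep (b : ℕ) {φ : (Π n, X n) → ℝ} (hφm : StronglyMeasurable φ) {R : ℝ}
    (hφR : ∀ x, |φ x| ≤ R) (h : Π i : Iic b, X i) (π : (i : ι) → Measure (E i))
    [∀ i, IsProbabilityMeasure (π i)] {T : ((i : ι) → E i) → X (b + 1)} (hT : Measurable T)
    (hrep : κ b h = (Measure.pi π).map T) {c : ι → ℝ} {d : (i : ι) → E i → E i → ℝ}
    (hdi : ∀ i a, Integrable (fun y => d i a y ^ 2) (π i)) {S : ι → ℝ}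
    (hS : ∀ i a, ∫ y, d i a y ^ 2 ∂π i ≤ S i)
    (hc : ∀ i ξ y, |fiberMean κ (b + 1) φ (succGlue b (h, T ξ)) -
        fiberMean κ (b + 1) φ (succGlue b (h, T (Function.update ξ i y)))| ≤ c i * d i (ξ i) y)
    (M : Finset ι) {Λ σsq : ℝ} (hcM : ∀ i ∈ M, |c i| ≤ Λ) (hc0 : ∀ i ∉ M, c i = 0)
    (hS0 : ∀ i, 0 ≤ S i) (hSσ : ∀ i, S i ≤ σsq) :
    oneStepVar κ b φ h ≤ (1 / 2 : ℝ) * (M.card * (Λ ^ 2 * σsq)) :=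
  (oneStepVar_le_of_rep b hφm hφR h π hT hrep hdi hS hc).trans (half_sum_sq_mul_le_card M hcM hc0 hS0 hSσ)

end ChainIncoherence

/-! ## §4  ANY version of the one-step conditional kernels realises the path law -/

section AnyVersion

variable {X : ℕ → Type*} [∀ n, MeasurableSpace (X n)]

/-- [folklore] **HISTORY LAWS FROM ANY DISINTEGRATING FAMILY.**  If Markov kernels `κ' b` disintegrate the finite path
law `μ` level by level (`μ.map (x≤b) ⊗ₘ κ' b = law of (x≤b, x (b+1))` for every `b`), then the tower realised from
the endpoint law `μ.map (· 0)` and `κ'` has the history laws of `μ`. -/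
theorem map_frestrictLe_trajMeasure_of_compProd (μ : Measure (Π n, X n)) [IsFiniteMeasure μ]
    (κ' : (b : ℕ) → Kernel (Π i : Iic b, X i) (X (b + 1))) [∀ b, IsMarkovKernel (κ' b)]
    (hκ' : ∀ b, μ.map (frestrictLe b) ⊗ₘ κ' b = μ.map (fun x => (frestrictLe b x, x (b + 1)))) (n : ℕ) :
    (Kernel.trajMeasure (μ.map (fun x => x 0)) κ').map (frestrictLe n) = μ.map (frestrictLe n) := by
  induction n with
  | zero =>
    rw [map_frestrictLe_zero_trajMeasure, Measure.map_map measurable_endpointHistory (measurable_pi_apply 0)]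
    congr 1
    funext x
    exact (frestrictLe_zero_eq_endpointHistory x).symm
  | succ b ih =>
    rw [map_frestrictLe_succ_eq_map_pair_map, map_frestrictLe_succ_eq_map_pair_map μ,
      ← map_frestrictLe_succ_eq_compProd, ih, hκ' b]

/-- [folklore] **EVERY VERSION OF THE BACKWARD KERNELS REALISES `μ`.**  Under the hypothesis of
`map_frestrictLe_trajMeasure_of_compProd`: `trajMeasure (μ.map (· 0)) κ' = μ`.  (So the product representation of §3
may be imposed on any convenient version of the conditional laws — e.g. the one the printed ℝ/T-operations define on
regular histories, modified arbitrarily on a null set of histories.) -/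
theorem trajMeasure_eq_of_compProd (μ : Measure (Π n, X n)) [IsFiniteMeasure μ]
    (κ' : (b : ℕ) → Kernel (Π i : Iic b, X i) (X (b + 1))) [∀ b, IsMarkovKernel (κ' b)]
    (hκ' : ∀ b, μ.map (frestrictLe b) ⊗ₘ κ' b = μ.map (fun x => (frestrictLe b x, x (b + 1)))) :
    Kernel.trajMeasure (μ.map (fun x => x 0)) κ' = μ := by
  have hP : IsProjectiveMeasureFamily (fun I : Finset ℕ => μ.map I.restrict) := by
    intro I J hJI
    rw [Measure.map_map (Finset.measurable_restrict₂ hJI) (Finset.measurable_restrict I),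
      Finset.restrict₂_comp_restrict hJI]
  have h1 : IsProjectiveLimit μ (fun I : Finset ℕ => μ.map I.restrict) := fun I => rfl
  have h2 : IsProjectiveLimit (Kernel.trajMeasure (μ.map (fun x => x 0)) κ')
      (fun I : Finset ℕ => μ.map I.restrict) := by
    rw [isProjectiveLimit_nat_iff hP]
    intro n
    exact map_frestrictLe_trajMeasure_of_compProd μ κ' hκ' n
  exact h2.unique h1

/-- [folklore] The posterior kernels of `T4CouplingChain` are one such version (so §4 strictly generalises
`T4CouplingChain.trajMeasure_posteriorKernel_eq`). -/
theorem trajMeasure_eq_of_compProd_posteriorKernel [∀ n, StandardBorelSpace (X n)] [∀ n, Nonempty (X n)]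
    (μ : Measure (Π n, X n)) [IsFiniteMeasure μ] :
    Kernel.trajMeasure (μ.map (fun x => x 0)) (posteriorKernel μ) = μ :=
  trajMeasure_eq_of_compProd μ (posteriorKernel μ) (map_frestrictLe_compProd_posteriorKernel μ)

end AnyVersion

/-! ## §5  ENVELOPES, end to end -/

section Envelope

variable {X : ℕ → Type*} [∀ n, MeasurableSpace (X n)]
variable {κ : (b : ℕ) → Kernel (Π i : Iic b, X i) (X (b + 1))} [∀ b, IsMarkovKernel (κ b)]

/-- [folklore] **(a) DETERMINISTIC ENVELOPE ⇒ TWO-SIDED MULTIPLICATIVE SANDWICH (realised chain).**  If the one-step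
variances have a history-free envelope `oneStepVar κ b φ h ≤ w b` (`b < n`) with `Σ_{b<n} w b ≤ W`, then for
`|t|·2R ≤ 1` and every measurable `0 ≤ g₀ ≤ Cg`:
`∫ g₀·e^{t·towerMean κ φ} dν ≤ ∫ g₀(x 0)·e^{tφ} dμ ≤ e^{t²W}·∫ g₀·e^{t·towerMean κ φ} dν` — NO additive error, NO
large-field event: the exceptional set of `T4CouplingChain.integral_mul_exp_le_condVar` is EMPTY. -/
theorem integral_mul_exp_sandwich_of_envelope (ν : Measure (X 0)) [IsFiniteMeasure ν] (n : ℕ)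
    {φ : (Π k, X k) → ℝ} (hφn : StronglyMeasurable[piLE (X := X) n] φ) {R : ℝ} (hφR : ∀ x, |φ x| ≤ R)
    {t : ℝ} (ht : |t| * (2 * R) ≤ 1) {g₀ : X 0 → ℝ} (hg : StronglyMeasurable g₀)
    (hg0 : ∀ z, 0 ≤ g₀ z) {Cg : ℝ} (hgC : ∀ z, g₀ z ≤ Cg)
    {w : ℕ → ℝ} (hW : ∀ b < n, ∀ h, oneStepVar κ b φ h ≤ w b) {W : ℝ} (hw : ∑ b ∈ range n, w b ≤ W) :
    ∫ z, g₀ z * Real.exp (t * towerMean κ φ z) ∂ν ≤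
        ∫ x, g₀ (x 0) * Real.exp (t * φ x) ∂(Kernel.trajMeasure ν κ) ∧
      ∫ x, g₀ (x 0) * Real.exp (t * φ x) ∂(Kernel.trajMeasure ν κ) ≤
        Real.exp (t ^ 2 * W) * ∫ z, g₀ z * Real.exp (t * towerMean κ φ z) ∂ν := by
  refine ⟨integral_mul_exp_towerMean_le ν n hφn hφR hg hg0 hgC t, ?_⟩
  have h := integral_mul_exp_le_condVar (κ := κ) ν n hφn hφR ht W hg hg0 hgC
  have hempty : {x : Π k, X k | W < ∑ b ∈ range n, oneStepVar κ b φ (frestrictLe b x)} = ∅ := by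
    ext x
    simp only [Set.mem_setOf_eq, Set.mem_empty_iff_false, iff_false, not_lt]
    exact (Finset.sum_le_sum fun b hb => hW b (mem_range.mp hb) _).trans hw
  rw [hempty, measureReal_empty, mul_zero, mul_zero, add_zero] at h
  exact h

/-- [folklore] **(b) DETERMINISTIC ENVELOPE ⇒ THE COMPLEX WINDOW ON THE FIBRES** (`T4PathwiseCouplingComplex`).  Under the
same envelope, for `μ`-a.e. fibre of the coarsest frame (`frameFiltration X n n = piLE 0`, the unit-lattice field) and
every complex `‖t‖ < 1/(4R)`: `E_fibre[e^{tφ}] = e^{t·E_fibre φ}·e^{Ψ}` with `‖Ψ‖ ≤ 8‖t‖²·W` — DRESSED = UNDRESSED ×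
`exp(t·h + Ψ_t)` at complex dressing parameter, fibrewise, with a `K`-uniform `Ψ`. -/
theorem ae_complexWindow_of_envelope [∀ n, StandardBorelSpace (X n)] (ν : Measure (X 0)) [IsFiniteMeasure ν]
    (n : ℕ) {φ : (Π k, X k) → ℝ} (hφn : StronglyMeasurable[piLE (X := X) n] φ) {R : ℝ} (hR : 0 < R)
    (hφR : ∀ x, |φ x| ≤ R) {w : ℕ → ℝ} (hW : ∀ b < n, ∀ h, oneStepVar κ b φ h ≤ w b) {W : ℝ}
    (hw : ∑ b ∈ range n, w b ≤ W) :
    ∀ᵐ x ∂(Kernel.trajMeasure ν κ), ∀ t : ℂ, ‖t‖ < (2 * R)⁻¹ / 2 →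
      ∃ Ψ : ℂ, ‖Ψ‖ ≤ 8 * ‖t‖ ^ 2 * W ∧
        complexMGF φ (condExpKernel (Kernel.trajMeasure ν κ) (frameFiltration X n n) x) t =
          Complex.exp (t * (∫ y, φ y ∂(condExpKernel (Kernel.trajMeasure ν κ) (frameFiltration X n n) x) : ℝ)) *
            Complex.exp Ψ := by
  have hφm : StronglyMeasurable φ := hφn.mono ((piLE (X := X)).le n)
  have hv := incrementVarBound_of_oneStepVar (κ := κ) ν n hφm hφR hW
  have hsum : ∑ i ∈ range n, w (n - (i + 1)) ≤ W := by rw [sum_range_reflect_succ w n]; exact hw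
  filter_upwards [ae_condExpKernel_dressing_eq_exp_of_incrementVarBound (μ := Kernel.trajMeasure ν κ)
    (antitone_frameFiltration (X := X) n) (frameFiltration_le (X := X) n) (stronglyMeasurable_frame_zero hφn)
    hR hφR n hv] with x hx t ht
  obtain ⟨Ψ, hΨ, hZ⟩ := hx t ht
  refine ⟨Ψ, hΨ.trans ?_, hZ⟩
  exact mul_le_mul_of_nonneg_left hsum (by positivity)

/-- [folklore] **(c) INTEGRATED ENVELOPE ⇒ MI-V.**  If measurable bounded per-history majorants `W b` dominate the
one-step variances (`oneStepVar κ b φ h ≤ W b h`, `b < n`), then the ONE NUMBER of `T4CouplingVariance` is at most their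
integrated sum: `∫ (φ − towerMean κ φ (x 0))² dμ ≤ Σ_{b<n} ∫ W b (x≤b) dμ`.  With `W b h := ½ Σᵢ c_{b,i}(h)² S_{b,i}`
from §3 the right side is the INTEGRATED SQUARED-SENSITIVITY BUDGET MI-ES of the record. -/
theorem integral_sq_sub_towerMean_le_of_majorant (ν : Measure (X 0)) [IsFiniteMeasure ν] (n : ℕ)
    {φ : (Π k, X k) → ℝ} (hφn : StronglyMeasurable[piLE (X := X) n] φ) {R : ℝ} (hφR : ∀ x, |φ x| ≤ R)
    {W : (b : ℕ) → (Π i : Iic b, X i) → ℝ} (hWm : ∀ b, StronglyMeasurable (W b)) {CW : ℝ}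
    (hWb : ∀ b h, |W b h| ≤ CW) (hW : ∀ b < n, ∀ h, oneStepVar κ b φ h ≤ W b h) :
    ∫ x, (φ x - towerMean κ φ (x 0)) ^ 2 ∂(Kernel.trajMeasure ν κ) ≤
      ∑ b ∈ range n, ∫ x, W b (frestrictLe b x) ∂(Kernel.trajMeasure ν κ) := by
  have hφm : StronglyMeasurable φ := hφn.mono ((piLE (X := X)).le n)
  rw [← sum_integral_oneStepVar_eq (κ := κ) ν n hφn hφR]
  refine Finset.sum_le_sum fun b hb => integral_mono ?_ ?_ fun x => hW b (mem_range.mp hb) _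
  · exact integrable_of_abs_le_const
      ((stronglyMeasurable_oneStepVar (κ := κ) b hφm).comp_measurable (measurable_frestrictLe b))
      fun x => abs_oneStepVar_le (κ := κ) b hφm hφR _
  · exact integrable_of_abs_le_const ((hWm b).comp_measurable (measurable_frestrictLe b)) fun x => hWb b _

/-- [folklore] **(c′) END-TO-END FROM AN INTEGRATED ENVELOPE (realised chain).**  `Σ_{b<n} ∫ W b (x≤b) dμ ≤ 𝒱` for
majorants as in (c) ⇒ the additive exponential-moment bound of `T4CouplingVariance.integral_mul_exp_le_of_condVariance`
with that `𝒱`: `∫ g₀(x 0)e^{tφ}dμ ≤ e^{t²B}∫ g₀e^{t·towerMean}dν + e^{|t|R}·Cg·B⁻¹·𝒱`. -/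
theorem integral_mul_exp_le_of_majorant (ν : Measure (X 0)) [IsFiniteMeasure ν] (n : ℕ)
    {φ : (Π k, X k) → ℝ} (hφn : StronglyMeasurable[piLE (X := X) n] φ) {R : ℝ} (hφR : ∀ x, |φ x| ≤ R)
    {t : ℝ} (ht : |t| * (2 * R) ≤ 1) {B : ℝ} (hB : 0 < B) {g₀ : X 0 → ℝ} (hg : StronglyMeasurable g₀)
    (hg0 : ∀ z, 0 ≤ g₀ z) {Cg : ℝ} (hCg : 0 ≤ Cg) (hgC : ∀ z, g₀ z ≤ Cg)
    {W : (b : ℕ) → (Π i : Iic b, X i) → ℝ} (hWm : ∀ b, StronglyMeasurable (W b)) {CW : ℝ}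
    (hWb : ∀ b h, |W b h| ≤ CW) (hW : ∀ b < n, ∀ h, oneStepVar κ b φ h ≤ W b h) {𝒱 : ℝ}
    (hV : ∑ b ∈ range n, ∫ x, W b (frestrictLe b x) ∂(Kernel.trajMeasure ν κ) ≤ 𝒱) :
    ∫ x, g₀ (x 0) * Real.exp (t * φ x) ∂(Kernel.trajMeasure ν κ) ≤
      Real.exp (t ^ 2 * B) * ∫ z, g₀ z * Real.exp (t * towerMean κ φ z) ∂ν +
        Real.exp (|t| * R) * (Cg * (B⁻¹ * 𝒱)) :=
  integral_mul_exp_le_of_condVariance (κ := κ) ν n hφn hφR ht hB hg hg0 hCg hgC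
    ((integral_sq_sub_towerMean_le_of_majorant (κ := κ) ν n hφn hφR hWm hWb hW).trans hV)

/-- [folklore] **(c″) THE TYPED INTEGRATED SQUARED-SENSITIVITY BUDGET (MI-ES shape).**  Step-dependent innovation
spaces `ι b`, laws `π b`, product representations `κ b h = (⊗ᵢ π b i).map (T b h)` of EVERY step law at EVERY
history, per-history sensitivities `c b h i` with kernels `d b i` of second moments `≤ S b i`, the budget
`h ↦ Σᵢ c b h i²·S b i` measurable and bounded: then
`∫ (φ − towerMean κ φ (x 0))² dμ ≤ Σ_{b<n} ∫ ½ Σᵢ c b (x≤b) i²·S b i dμ`.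
The right side `≤ 𝒱(ḡ, |C|, L)` — μ-, K- and volume-free and `→ 0` with `ḡ` — is the record's MI-ES, the ONLY
smallness input the fluctuation half of NE1′ then needs (`integral_mul_exp_le_of_majorant`). -/
theorem integral_sq_sub_towerMean_le_sensitivityBudget (ν : Measure (X 0)) [IsFiniteMeasure ν] (n : ℕ)
    {φ : (Π k, X k) → ℝ} (hφn : StronglyMeasurable[piLE (X := X) n] φ) {R : ℝ} (hφR : ∀ x, |φ x| ≤ R)
    {ι : ℕ → Type u} [∀ b, Fintype (ι b)] [∀ b, DecidableEq (ι b)] {E : (b : ℕ) → ι b → Type v}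
    [∀ b i, MeasurableSpace (E b i)] (π : (b : ℕ) → (i : ι b) → Measure (E b i))
    [∀ b i, IsProbabilityMeasure (π b i)]
    {T : (b : ℕ) → (Π i : Iic b, X i) → ((i : ι b) → E b i) → X (b + 1)} (hT : ∀ b h, Measurable (T b h))
    (hrep : ∀ b < n, ∀ h, κ b h = (Measure.pi (π b)).map (T b h))
    {c : (b : ℕ) → (Π i : Iic b, X i) → ι b → ℝ} {d : (b : ℕ) → (i : ι b) → E b i → E b i → ℝ}
    (hdi : ∀ b i a, Integrable (fun y => d b i a y ^ 2) (π b i)) {S : (b : ℕ) → ι b → ℝ}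
    (hS : ∀ b i a, ∫ y, d b i a y ^ 2 ∂π b i ≤ S b i)
    (hc : ∀ b < n, ∀ h i ξ y, |fiberMean κ (b + 1) φ (succGlue b (h, T b h ξ)) -
        fiberMean κ (b + 1) φ (succGlue b (h, T b h (Function.update ξ i y)))| ≤ c b h i * d b i (ξ i) y)
    (hWm : ∀ b, StronglyMeasurable (fun h => ∑ i, c b h i ^ 2 * S b i)) {CW : ℝ}
    (hWb : ∀ b h, |∑ i, c b h i ^ 2 * S b i| ≤ CW) :
    ∫ x, (φ x - towerMean κ φ (x 0)) ^ 2 ∂(Kernel.trajMeasure ν κ) ≤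
      ∑ b ∈ range n, ∫ x, (1 / 2 : ℝ) * ∑ i, c b (frestrictLe b x) i ^ 2 * S b i ∂(Kernel.trajMeasure ν κ) := by
  have hφm : StronglyMeasurable φ := hφn.mono ((piLE (X := X)).le n)
  refine integral_sq_sub_towerMean_le_of_majorant (κ := κ) ν n hφn hφR
    (W := fun b h => (1 / 2 : ℝ) * ∑ i, c b h i ^ 2 * S b i) (fun b => (hWm b).const_mul _)
    (CW := (1 / 2 : ℝ) * CW) (fun b h => ?_) fun b hb h => ?_
  · rw [abs_mul, abs_of_nonneg (by norm_num : (0 : ℝ) ≤ 1 / 2)]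
    exact mul_le_mul_of_nonneg_left (hWb b h) (by norm_num)
  · exact oneStepVar_le_of_rep b hφm hφR h (π b) (hT b h) (hrep b hb h) (hdi b) (hS b) (hc b hb h)

end Envelope

/-! ### §5(d)  Path-law forms (an ARBITRARY finite path law on standard Borel carriers, ANY kernel version) -/

section EnvelopePathLaw

variable {X : ℕ → Type*} [∀ n, MeasurableSpace (X n)]

/-- [folklore] **TWO-SIDED SANDWICH FOR AN ARBITRARY PATH LAW AND ANY KERNEL VERSION.**  `μ` a finite path law, `κ'`
any level-by-level disintegration of it (§4), `φ` bounded `piLE n`-measurable with a deterministic one-step-variance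
envelope of total `W` for `κ'`: for `|t|·2R ≤ 1`, `0 ≤ g₀ ≤ Cg` measurable,
`∫ g₀(x 0)e^{t·towerMean κ' φ (x 0)}dμ ≤ ∫ g₀(x 0)e^{tφ}dμ ≤ e^{t²W}·∫ g₀(x 0)e^{t·towerMean κ' φ (x 0)}dμ`.
In the dictionary: the dressed unit-lattice expectation of any bounded non-negative function of the unit-lattice field
is within the factor `e^{t²W}` of the NAIVELY REWEIGHTED undressed one (weight `e^{t·E[φ∣V_K]}`), uniformly in `K`,
in the volume and in everything `W` does not see. -/
theorem integral_mul_exp_sandwich_of_envelope_pathLaw (μ : Measure (Π n, X n)) [IsFiniteMeasure μ]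
    (κ' : (b : ℕ) → Kernel (Π i : Iic b, X i) (X (b + 1))) [∀ b, IsMarkovKernel (κ' b)]
    (hκ' : ∀ b, μ.map (frestrictLe b) ⊗ₘ κ' b = μ.map (fun x => (frestrictLe b x, x (b + 1)))) (n : ℕ)
    {φ : (Π k, X k) → ℝ} (hφn : StronglyMeasurable[piLE (X := X) n] φ) {R : ℝ} (hφR : ∀ x, |φ x| ≤ R)
    {t : ℝ} (ht : |t| * (2 * R) ≤ 1) {g₀ : X 0 → ℝ} (hg : StronglyMeasurable g₀)
    (hg0 : ∀ z, 0 ≤ g₀ z) {Cg : ℝ} (hgC : ∀ z, g₀ z ≤ Cg)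
    {w : ℕ → ℝ} (hW : ∀ b < n, ∀ h, oneStepVar κ' b φ h ≤ w b) {W : ℝ} (hw : ∑ b ∈ range n, w b ≤ W) :
    ∫ x, g₀ (x 0) * Real.exp (t * towerMean κ' φ (x 0)) ∂μ ≤ ∫ x, g₀ (x 0) * Real.exp (t * φ x) ∂μ ∧
      ∫ x, g₀ (x 0) * Real.exp (t * φ x) ∂μ ≤
        Real.exp (t ^ 2 * W) * ∫ x, g₀ (x 0) * Real.exp (t * towerMean κ' φ (x 0)) ∂μ := by
  have hφm : StronglyMeasurable φ := hφn.mono ((piLE (X := X)).le n)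
  have h := integral_mul_exp_sandwich_of_envelope (κ := κ') (μ.map (fun x => x 0)) n hφn hφR ht hg hg0 hgC hW hw
  rw [trajMeasure_eq_of_compProd μ κ' hκ'] at h
  have hG : AEStronglyMeasurable (fun z => g₀ z * Real.exp (t * towerMean κ' φ z)) (μ.map (fun x => x 0)) :=
    (hg.measurable.mul (((stronglyMeasurable_towerMean (κ := κ') hφm).measurable.const_mul t).exp)).aestronglyMeasurable
  rw [integral_map (measurable_pi_apply 0).aemeasurable hG] at h
  exact h

variable [∀ n, StandardBorelSpace (X n)] [∀ n, Nonempty (X n)]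

/-- [folklore] **TWO-SIDED SANDWICH FOR AN ARBITRARY PATH LAW, posterior version** (`κ' := posteriorKernel μ`). -/
theorem integral_mul_exp_sandwich_of_envelope_posterior (μ : Measure (Π n, X n)) [IsFiniteMeasure μ] (n : ℕ)
    {φ : (Π k, X k) → ℝ} (hφn : StronglyMeasurable[piLE (X := X) n] φ) {R : ℝ} (hφR : ∀ x, |φ x| ≤ R)
    {t : ℝ} (ht : |t| * (2 * R) ≤ 1) {g₀ : X 0 → ℝ} (hg : StronglyMeasurable g₀)
    (hg0 : ∀ z, 0 ≤ g₀ z) {Cg : ℝ} (hgC : ∀ z, g₀ z ≤ Cg)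
    {w : ℕ → ℝ} (hW : ∀ b < n, ∀ h, oneStepVar (posteriorKernel μ) b φ h ≤ w b) {W : ℝ}
    (hw : ∑ b ∈ range n, w b ≤ W) :
    ∫ x, g₀ (x 0) * Real.exp (t * towerMean (posteriorKernel μ) φ (x 0)) ∂μ ≤
        ∫ x, g₀ (x 0) * Real.exp (t * φ x) ∂μ ∧
      ∫ x, g₀ (x 0) * Real.exp (t * φ x) ∂μ ≤
        Real.exp (t ^ 2 * W) * ∫ x, g₀ (x 0) * Real.exp (t * towerMean (posteriorKernel μ) φ (x 0)) ∂μ :=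
  integral_mul_exp_sandwich_of_envelope_pathLaw μ (posteriorKernel μ) (map_frestrictLe_compProd_posteriorKernel μ)
    n hφn hφR ht hg hg0 hgC hW hw

omit [∀ n, Nonempty (X n)] in
/-- [folklore] **THE COMPLEX WINDOW FOR AN ARBITRARY PATH LAW** from a deterministic envelope for any kernel version:
for `μ`-a.e. fibre of the unit-lattice field and complex `‖t‖ < 1/(4R)`, `E[e^{tφ}∣fibre] = e^{t·E[φ∣fibre]}·e^{Ψ}`,
`‖Ψ‖ ≤ 8‖t‖²W`. -/
theorem ae_complexWindow_of_envelope_pathLaw (μ : Measure (Π n, X n)) [IsFiniteMeasure μ]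
    (κ' : (b : ℕ) → Kernel (Π i : Iic b, X i) (X (b + 1))) [∀ b, IsMarkovKernel (κ' b)]
    (hκ' : ∀ b, μ.map (frestrictLe b) ⊗ₘ κ' b = μ.map (fun x => (frestrictLe b x, x (b + 1)))) (n : ℕ)
    {φ : (Π k, X k) → ℝ} (hφn : StronglyMeasurable[piLE (X := X) n] φ) {R : ℝ} (hR : 0 < R)
    (hφR : ∀ x, |φ x| ≤ R) {w : ℕ → ℝ} (hW : ∀ b < n, ∀ h, oneStepVar κ' b φ h ≤ w b) {W : ℝ}
    (hw : ∑ b ∈ range n, w b ≤ W) :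
    ∀ᵐ x ∂μ, ∀ t : ℂ, ‖t‖ < (2 * R)⁻¹ / 2 →
      ∃ Ψ : ℂ, ‖Ψ‖ ≤ 8 * ‖t‖ ^ 2 * W ∧
        complexMGF φ (condExpKernel μ (frameFiltration X n n) x) t =
          Complex.exp (t * (∫ y, φ y ∂(condExpKernel μ (frameFiltration X n n) x) : ℝ)) * Complex.exp Ψ := by
  have hφm : StronglyMeasurable φ := hφn.mono ((piLE (X := X)).le n)
  have hv := incrementVarBound_of_oneStepVar (κ := κ') (μ.map (fun x => x 0)) n hφm hφR hW
  rw [trajMeasure_eq_of_compProd μ κ' hκ'] at hv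
  have hsum : ∑ i ∈ range n, w (n - (i + 1)) ≤ W := by rw [sum_range_reflect_succ w n]; exact hw
  filter_upwards [ae_condExpKernel_dressing_eq_exp_of_incrementVarBound (μ := μ)
    (antitone_frameFiltration (X := X) n) (frameFiltration_le (X := X) n) (stronglyMeasurable_frame_zero hφn)
    hR hφR n hv] with x hx t ht
  obtain ⟨Ψ, hΨ, hZ⟩ := hx t ht
  exact ⟨Ψ, hΨ.trans (mul_le_mul_of_nonneg_left hsum (by positivity)), hZ⟩

/-- [folklore] **MI-V FROM AN INTEGRATED ENVELOPE, ARBITRARY PATH LAW** (`κ' := posteriorKernel μ`):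
`∫ (φ − towerMean (posteriorKernel μ) φ (x 0))² dμ ≤ Σ_{b<n} ∫ W b (x≤b) dμ`. -/
theorem integral_sq_sub_towerMean_le_of_majorant_pathLaw (μ : Measure (Π n, X n)) [IsFiniteMeasure μ] (n : ℕ)
    {φ : (Π k, X k) → ℝ} (hφn : StronglyMeasurable[piLE (X := X) n] φ) {R : ℝ} (hφR : ∀ x, |φ x| ≤ R)
    {W : (b : ℕ) → (Π i : Iic b, X i) → ℝ} (hWm : ∀ b, StronglyMeasurable (W b)) {CW : ℝ}
    (hWb : ∀ b h, |W b h| ≤ CW) (hW : ∀ b < n, ∀ h, oneStepVar (posteriorKernel μ) b φ h ≤ W b h) :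
    ∫ x, (φ x - towerMean (posteriorKernel μ) φ (x 0)) ^ 2 ∂μ ≤
      ∑ b ∈ range n, ∫ x, W b (frestrictLe b x) ∂μ := by
  have h := integral_sq_sub_towerMean_le_of_majorant (κ := posteriorKernel μ) (μ.map (fun x => x 0)) n hφn hφR
    hWm hWb hW
  rwa [trajMeasure_posteriorKernel_eq μ] at h

end EnvelopePathLaw

/-! ## §6  POWER COUNTING as arithmetic: the geometric envelope of NE1′ -/

section PowerCounting

/-- [folklore] (arithmetic) **ONE STEP OF THE ENVELOPE**: `#M ≤ P·G^b` felt innovations, sensitivity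
`0 ≤ Λ_b ≤ Λ₀·θ^b`, second moments `≤ σ² ≥ 0` ⇒ `½·#M·Λ_b²·σ² ≤ (½PΛ₀²σ²)·(Gθ²)^b`. -/
theorem half_card_mul_le_geometric {Nb Λb P G Λ₀ θ σsq : ℝ} (b : ℕ) (hP : 0 ≤ P) (hG : 0 ≤ G)
    (hσ : 0 ≤ σsq) (hN : Nb ≤ P * G ^ b) (hΛb : 0 ≤ Λb) (hΛ : Λb ≤ Λ₀ * θ ^ b) :
    (1 / 2 : ℝ) * (Nb * (Λb ^ 2 * σsq)) ≤ (1 / 2 : ℝ) * (P * (Λ₀ ^ 2 * σsq)) * (G * θ ^ 2) ^ b := by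
  have h1 : Λb ^ 2 ≤ (Λ₀ * θ ^ b) ^ 2 := pow_le_pow_left₀ hΛb hΛ 2
  have h2 : Λb ^ 2 * σsq ≤ (Λ₀ * θ ^ b) ^ 2 * σsq := mul_le_mul_of_nonneg_right h1 hσ
  have h3 : Nb * (Λb ^ 2 * σsq) ≤ P * G ^ b * ((Λ₀ * θ ^ b) ^ 2 * σsq) :=
    mul_le_mul hN h2 (mul_nonneg (sq_nonneg _) hσ) (mul_nonneg hP (pow_nonneg hG _))
  have h4 : P * G ^ b * ((Λ₀ * θ ^ b) ^ 2 * σsq) = P * (Λ₀ ^ 2 * σsq) * (G * θ ^ 2) ^ b := by ring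
  rw [h4] at h3
  linarith

/-- [folklore] (arithmetic) **A GEOMETRIC ENVELOPE IS SUMMABLE UNIFORMLY IN THE DEPTH**: `w b ≤ A·r^b` with `0 ≤ A`,
`0 ≤ r < 1` ⇒ `Σ_{b<n} w b ≤ A/(1−r)` for every `n`. -/
theorem sum_le_div_of_le_geometric {w : ℕ → ℝ} {A r : ℝ} (hA : 0 ≤ A) (hr0 : 0 ≤ r) (hr1 : r < 1)
    (hw : ∀ b, w b ≤ A * r ^ b) (n : ℕ) : ∑ b ∈ range n, w b ≤ A / (1 - r) := by
  calc ∑ b ∈ range n, w b ≤ ∑ b ∈ range n, A * r ^ b := Finset.sum_le_sum fun b _ => hw b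
    _ = A * ∑ b ∈ range n, r ^ b := by rw [Finset.mul_sum]
    _ ≤ A * ∑' b, r ^ b :=
        mul_le_mul_of_nonneg_left ((summable_geometric_of_lt_one hr0 hr1).sum_le_tsum (range n)
          fun b _ => pow_nonneg hr0 b) hA
    _ = A / (1 - r) := by rw [tsum_geometric_of_lt_one hr0 hr1, div_eq_mul_inv]

/-- [folklore] (arithmetic) **THE NE1′ RATE**: with `G = L⁴` (worst-case growth per level of the number of blocks felt
by a unit loop tube, `d = 4`) and `θ = θ₁ = L^{-3}` (`T4LoopPullback.theta1_exact`), `0 ≤ Gθ² < 1` for `2 ≤ L`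
(`T4PathwiseCoupling.ne1p_sqRate_lt_one`: `Gθ² = L^{-2}`). -/
theorem ne1p_sqRate_nonneg_lt_one {L : ℝ} (hL : 2 ≤ L) :
    0 ≤ L ^ 4 * (L⁻¹ ^ 3) ^ 2 ∧ L ^ 4 * (L⁻¹ ^ 3) ^ 2 < 1 :=
  ⟨mul_nonneg (pow_nonneg (by linarith) _) (sq_nonneg _), ne1p_sqRate_lt_one hL⟩

variable {X : ℕ → Type*} [∀ n, MeasurableSpace (X n)]
variable {κ : (b : ℕ) → Kernel (Π i : Iic b, X i) (X (b + 1))} [∀ b, IsMarkovKernel (κ b)]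

/-- [folklore] **END-TO-END UNDER A GEOMETRIC ENVELOPE (realised chain).**  If every one-step variance obeys
`oneStepVar κ b φ h ≤ A·r^b` (`0 ≤ A`, `0 ≤ r < 1`; by §3 + `half_card_mul_le_geometric` this is the shape
`½·#M_b(h)·Λ_b²·σ² ≤ ½PΛ₀²σ²·(Gθ²)^b`), then for `|t|·2R ≤ 1`, `0 ≤ g₀ ≤ Cg` measurable and EVERY depth `n`:
`∫ g₀e^{t·towerMean}dν ≤ ∫ g₀(x 0)e^{tφ}dμ ≤ e^{t²A/(1−r)}·∫ g₀e^{t·towerMean}dν`. -/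
theorem integral_mul_exp_sandwich_of_geometric_envelope (ν : Measure (X 0)) [IsFiniteMeasure ν] (n : ℕ)
    {φ : (Π k, X k) → ℝ} (hφn : StronglyMeasurable[piLE (X := X) n] φ) {R : ℝ} (hφR : ∀ x, |φ x| ≤ R)
    {t : ℝ} (ht : |t| * (2 * R) ≤ 1) {g₀ : X 0 → ℝ} (hg : StronglyMeasurable g₀)
    (hg0 : ∀ z, 0 ≤ g₀ z) {Cg : ℝ} (hgC : ∀ z, g₀ z ≤ Cg) {A r : ℝ} (hA : 0 ≤ A) (hr0 : 0 ≤ r) (hr1 : r < 1)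
    (hW : ∀ b < n, ∀ h, oneStepVar κ b φ h ≤ A * r ^ b) :
    ∫ z, g₀ z * Real.exp (t * towerMean κ φ z) ∂ν ≤
        ∫ x, g₀ (x 0) * Real.exp (t * φ x) ∂(Kernel.trajMeasure ν κ) ∧
      ∫ x, g₀ (x 0) * Real.exp (t * φ x) ∂(Kernel.trajMeasure ν κ) ≤
        Real.exp (t ^ 2 * (A / (1 - r))) * ∫ z, g₀ z * Real.exp (t * towerMean κ φ z) ∂ν :=
  integral_mul_exp_sandwich_of_envelope ν n hφn hφR ht hg hg0 hgC hW
    (sum_le_div_of_le_geometric hA hr0 hr1 (fun _ => le_rfl) n)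

end PowerCounting

/-! ## §7  ROBUST INCOHERENCE (v2, append-only): DOMINATED product representations, GRADED sensitivities,
and the end-to-end PRIMITIVE FORM of MI-ES -/

/-! ### §7(a)  Integrals and variances under a DOMINATED law -/

section Dominated

variable {Y : Type*} [MeasurableSpace Y]

/-- [folklore] **INTEGRAL OF A NON-NEGATIVE FUNCTION UNDER A DOMINATED MEASURE**: `ρ ≤ M•ρ'` (as measures, `0 ≤ M`),
`f ≥ 0` integrable for `ρ'` ⇒ `∫ f dρ ≤ M·∫ f dρ'`. -/
theorem integral_le_mul_of_dominated {ρ ρ' : Measure Y} {M : ℝ} (hM : 0 ≤ M)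
    (hdom : ρ ≤ ENNReal.ofReal M • ρ') {f : Y → ℝ} (hf0 : ∀ y, 0 ≤ f y) (hfi : Integrable f ρ') :
    ∫ y, f y ∂ρ ≤ M * ∫ y, f y ∂ρ' := by
  have hfi' : Integrable f (ENNReal.ofReal M • ρ') := hfi.smul_measure ENNReal.ofReal_ne_top
  calc ∫ y, f y ∂ρ ≤ ∫ y, f y ∂(ENNReal.ofReal M • ρ') :=
        integral_mono_measure hdom (ae_of_all _ hf0) hfi'
    _ = M * ∫ y, f y ∂ρ' := by rw [integral_smul_measure, ENNReal.toReal_ofReal hM, smul_eq_mul]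

variable {X : ℕ → Type*} [∀ n, MeasurableSpace (X n)]
variable {κ : (b : ℕ) → Kernel (Π i : Iic b, X i) (X (b + 1))} [∀ b, IsMarkovKernel (κ b)]

/-- [folklore] **THE ONE-STEP VARIANCE IS AT MOST THE ONE-STEP SECOND MOMENT ABOUT ANY CONSTANT, kernel form**:
`oneStepVar κ b φ h ≤ ∫ (fiberMean κ (b+1) φ (succGlue b (h, y)) − a)² d(κ b h)(y)` for every real `a`. -/
theorem oneStepVar_le_integral_kernel_sq_sub_const (b : ℕ) {φ : (Π n, X n) → ℝ} (hφm : StronglyMeasurable φ)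
    {R : ℝ} (hφR : ∀ x, |φ x| ≤ R) (h : Π i : Iic b, X i) (a : ℝ) :
    oneStepVar κ b φ h ≤ ∫ y, (fiberMean κ (b + 1) φ (succGlue b (h, y)) - a) ^ 2 ∂(κ b h) := by
  have hG : StronglyMeasurable (fun u : (Π i : Iic (b + 1), X i) => (fiberMean κ (b + 1) φ u - a) ^ 2) :=
    ((stronglyMeasurable_fiberMean _ hφm).sub stronglyMeasurable_const).pow 2
  have h1 := oneStepVar_le_integral_sq_sub_const (κ := κ) b hφm hφR h a
  rwa [integral_partialTraj_succ b h hG] at h1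

/-- [folklore] **ONE-STEP VARIANCE UNDER A DOMINATED STEP LAW.**  If the step law at the history `h` is dominated,
`κ b h ≤ M•ρ'` (`ρ'` any finite measure on the next level, `0 ≤ M`), then for every constant `a`:
`oneStepVar κ b φ h ≤ M·∫ (fiberMean κ (b+1) φ (succGlue b (h, y)) − a)² dρ'(y)`.  In the dictionary `ρ'` is a
REFERENCE law with exact structure (a product over components, §7(b)) and `M = M_b(h) ≥ 1` the density-ratio slack
of the true posterior against it (approximate conditional independence: Gibbs–Markov factorisation given the outside
of the components, spoiled only by the small non-local terms of the effective action). -/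
theorem oneStepVar_le_of_dominated (b : ℕ) {φ : (Π n, X n) → ℝ} (hφm : StronglyMeasurable φ)
    {R : ℝ} (hφR : ∀ x, |φ x| ≤ R) (h : Π i : Iic b, X i) (ρ' : Measure (X (b + 1))) [IsFiniteMeasure ρ']
    {M : ℝ} (hM : 0 ≤ M) (hdom : κ b h ≤ ENNReal.ofReal M • ρ') (a : ℝ) :
    oneStepVar κ b φ h ≤ M * ∫ y, (fiberMean κ (b + 1) φ (succGlue b (h, y)) - a) ^ 2 ∂ρ' := by
  have hGm : StronglyMeasurable (fun y : X (b + 1) => (fiberMean κ (b + 1) φ (succGlue b (h, y)) - a) ^ 2) :=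
    (((stronglyMeasurable_fiberMean _ hφm).comp_measurable (measurable_succGlue_mk b h)).sub
      stronglyMeasurable_const).pow 2
  refine (oneStepVar_le_integral_kernel_sq_sub_const b hφm hφR h a).trans
    (integral_le_mul_of_dominated hM hdom (fun y => sq_nonneg _) ?_)
  exact integrable_of_abs_le_const hGm (R := (R + |a|) ^ 2) fun y => by
    rw [abs_of_nonneg (sq_nonneg _), ← sq_abs]
    exact pow_le_pow_left₀ (abs_nonneg _)
      ((abs_sub _ _).trans (add_le_add (abs_fiberMean_le (κ := κ) _ hφm hφR _) le_rfl)) 2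

end Dominated

/-! ### §7(b)  ONE-STEP INCOHERENCE under a DOMINATED PRODUCT REPRESENTATION -/

section DominatedRep

variable {X : ℕ → Type*} [∀ n, MeasurableSpace (X n)]
variable {κ : (b : ℕ) → Kernel (Π i : Iic b, X i) (X (b + 1))} [∀ b, IsMarkovKernel (κ b)]
variable {ι : Type u} [Fintype ι] [DecidableEq ι] {E : ι → Type v} [∀ i, MeasurableSpace (E i)]

omit [DecidableEq ι] in
/-- [folklore] **ONE-STEP VARIANCE ≤ M × VARIANCE ON THE INNOVATION SPACE** under a dominated product representation
`κ b h ≤ M•(⊗ᵢ πᵢ).map T`. -/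
theorem oneStepVar_le_mul_integral_pi_of_dominatedRep (b : ℕ) {φ : (Π n, X n) → ℝ} (hφm : StronglyMeasurable φ)
    {R : ℝ} (hφR : ∀ x, |φ x| ≤ R) (h : Π i : Iic b, X i) (π : (i : ι) → Measure (E i))
    [∀ i, IsProbabilityMeasure (π i)] {T : ((i : ι) → E i) → X (b + 1)} (hT : Measurable T)
    {M : ℝ} (hM : 0 ≤ M) (hdom : κ b h ≤ ENNReal.ofReal M • (Measure.pi π).map T) :
    oneStepVar κ b φ h ≤ M * ∫ ξ, (fiberMean κ (b + 1) φ (succGlue b (h, T ξ)) -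
        ∫ ζ, fiberMean κ (b + 1) φ (succGlue b (h, T ζ)) ∂Measure.pi π) ^ 2 ∂Measure.pi π := by
  set a : ℝ := ∫ ζ, fiberMean κ (b + 1) φ (succGlue b (h, T ζ)) ∂Measure.pi π with ha
  have hGm : StronglyMeasurable (fun y : X (b + 1) => (fiberMean κ (b + 1) φ (succGlue b (h, y)) - a) ^ 2) :=
    (((stronglyMeasurable_fiberMean _ hφm).comp_measurable (measurable_succGlue_mk b h)).sub
      stronglyMeasurable_const).pow 2
  have h1 := oneStepVar_le_of_dominated b hφm hφR h ((Measure.pi π).map T) hM hdom a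
  rwa [integral_map hT.aemeasurable hGm.aestronglyMeasurable] at h1

/-- [folklore] **ROBUST ONE-STEP INCOHERENCE.**  Under a DOMINATED product representation
`κ b h ≤ M•(⊗ᵢ πᵢ).map T` (`0 ≤ M`) of the step law at the history `h`: single-innovation sensitivities
`|g ξ − g (ξ with ξᵢ := y)| ≤ cᵢ·dᵢ(ξᵢ, y)` of the next effective observable `g ξ = fiberMean κ (b+1) φ (succGlue b
(h, T ξ))` with `∫ dᵢ(a,·)² dπᵢ ≤ Sᵢ` give `oneStepVar κ b φ h ≤ M·½Σᵢ cᵢ²·Sᵢ`. -/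
theorem oneStepVar_le_of_dominatedRep (b : ℕ) {φ : (Π n, X n) → ℝ} (hφm : StronglyMeasurable φ) {R : ℝ}
    (hφR : ∀ x, |φ x| ≤ R) (h : Π i : Iic b, X i) (π : (i : ι) → Measure (E i))
    [∀ i, IsProbabilityMeasure (π i)] {T : ((i : ι) → E i) → X (b + 1)} (hT : Measurable T)
    {M : ℝ} (hM : 0 ≤ M) (hdom : κ b h ≤ ENNReal.ofReal M • (Measure.pi π).map T)
    {c : ι → ℝ} {d : (i : ι) → E i → E i → ℝ}
    (hdi : ∀ i a, Integrable (fun y => d i a y ^ 2) (π i)) {S : ι → ℝ}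
    (hS : ∀ i a, ∫ y, d i a y ^ 2 ∂π i ≤ S i)
    (hc : ∀ i ξ y, |fiberMean κ (b + 1) φ (succGlue b (h, T ξ)) -
        fiberMean κ (b + 1) φ (succGlue b (h, T (Function.update ξ i y)))| ≤ c i * d i (ξ i) y) :
    oneStepVar κ b φ h ≤ M * ((1 / 2 : ℝ) * ∑ i, c i ^ 2 * S i) := by
  have hgm : Measurable (fun ξ => fiberMean κ (b + 1) φ (succGlue b (h, T ξ))) :=
    (stronglyMeasurable_fiberMean _ hφm).measurable.comp ((measurable_succGlue_mk b h).comp hT)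
  exact (oneStepVar_le_mul_integral_pi_of_dominatedRep b hφm hφR h π hT hM hdom).trans
    (mul_le_mul_of_nonneg_left
      (integral_sq_sub_integral_le_sum_sensitivity π hgm (fun ξ => abs_fiberMean_le _ hφm hφR _) hdi hS hc) hM)

/-- [folklore] **ROBUST ONE-STEP INCOHERENCE, integrated-sensitivity form** (`Vᵢ(ξ)` dominating the inner resampling
second moments): `oneStepVar κ b φ h ≤ M·½Σᵢ∫Vᵢ dΠ`. -/
theorem oneStepVar_le_of_dominatedRep_inner (b : ℕ) {φ : (Π n, X n) → ℝ} (hφm : StronglyMeasurable φ) {R : ℝ}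
    (hφR : ∀ x, |φ x| ≤ R) (h : Π i : Iic b, X i) (π : (i : ι) → Measure (E i))
    [∀ i, IsProbabilityMeasure (π i)] {T : ((i : ι) → E i) → X (b + 1)} (hT : Measurable T)
    {M : ℝ} (hM : 0 ≤ M) (hdom : κ b h ≤ ENNReal.ofReal M • (Measure.pi π).map T)
    {V : ι → ((i : ι) → E i) → ℝ}
    (hin : ∀ i ξ, ∫ y, (fiberMean κ (b + 1) φ (succGlue b (h, T ξ)) -
        fiberMean κ (b + 1) φ (succGlue b (h, T (Function.update ξ i y)))) ^ 2 ∂π i ≤ V i ξ)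
    (hVi : ∀ i, Integrable (V i) (Measure.pi π)) :
    oneStepVar κ b φ h ≤ M * ((1 / 2 : ℝ) * ∑ i, ∫ ξ, V i ξ ∂Measure.pi π) := by
  have hgm : Measurable (fun ξ => fiberMean κ (b + 1) φ (succGlue b (h, T ξ))) :=
    (stronglyMeasurable_fiberMean _ hφm).measurable.comp ((measurable_succGlue_mk b h).comp hT)
  exact (oneStepVar_le_mul_integral_pi_of_dominatedRep b hφm hφR h π hT hM hdom).trans
    (mul_le_mul_of_nonneg_left
      (integral_sq_sub_integral_le_sum_of_inner π hgm (fun ξ => abs_fiberMean_le _ hφm hφR _) hin hVi) hM)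

/-- [folklore] **ROBUST ONE-STEP INCOHERENCE, counting form**: felt set `M₀`, `|cᵢ| ≤ Λ` on it, `cᵢ = 0` off it,
`0 ≤ Sᵢ ≤ σ²` ⇒ `oneStepVar κ b φ h ≤ M·½·#M₀·Λ²σ²`. -/
theorem oneStepVar_le_card_of_dominatedRep (b : ℕ) {φ : (Π n, X n) → ℝ} (hφm : StronglyMeasurable φ) {R : ℝ}
    (hφR : ∀ x, |φ x| ≤ R) (h : Π i : Iic b, X i) (π : (i : ι) → Measure (E i))
    [∀ i, IsProbabilityMeasure (π i)] {T : ((i : ι) → E i) → X (b + 1)} (hT : Measurable T)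
    {M : ℝ} (hM : 0 ≤ M) (hdom : κ b h ≤ ENNReal.ofReal M • (Measure.pi π).map T)
    {c : ι → ℝ} {d : (i : ι) → E i → E i → ℝ}
    (hdi : ∀ i a, Integrable (fun y => d i a y ^ 2) (π i)) {S : ι → ℝ}
    (hS : ∀ i a, ∫ y, d i a y ^ 2 ∂π i ≤ S i)
    (hc : ∀ i ξ y, |fiberMean κ (b + 1) φ (succGlue b (h, T ξ)) -
        fiberMean κ (b + 1) φ (succGlue b (h, T (Function.update ξ i y)))| ≤ c i * d i (ξ i) y)
    (M₀ : Finset ι) {Λ σsq : ℝ} (hcM : ∀ i ∈ M₀, |c i| ≤ Λ) (hc0 : ∀ i ∉ M₀, c i = 0)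
    (hS0 : ∀ i, 0 ≤ S i) (hSσ : ∀ i, S i ≤ σsq) :
    oneStepVar κ b φ h ≤ M * ((1 / 2 : ℝ) * (M₀.card * (Λ ^ 2 * σsq))) :=
  (oneStepVar_le_of_dominatedRep b hφm hφR h π hT hM hdom hdi hS hc).trans
    (mul_le_mul_of_nonneg_left (half_sum_sq_mul_le_card M₀ hcM hc0 hS0 hSσ) hM)

omit [∀ b, IsMarkovKernel (κ b)] [DecidableEq ι] in
/-- [folklore] The exact representation of §3 is the case `M = 1`. -/
theorem dominated_of_rep (b : ℕ) (h : Π i : Iic b, X i) (π : (i : ι) → Measure (E i))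
    {T : ((i : ι) → E i) → X (b + 1)} (hrep : κ b h = (Measure.pi π).map T) :
    κ b h ≤ ENNReal.ofReal 1 • (Measure.pi π).map T := by
  rw [ENNReal.ofReal_one, one_smul, hrep]

end DominatedRep

/-! ### §7(c)  GRADED SENSITIVITIES and PRODUCT DOMINATION OF THE GRADING EVENTS ⇒ the integrated budget

The record's (A1⁗)(3): the contraction of the averaging maps from the resampled level up to the unit lattice is
`θ` per REGULAR coarser level and at worst `1` (a loss factor `κ₁ = θ⁻¹ ≥ 1` relative to `θ`) per IRREGULAR one; the
irregular levels over a felt slot are EVENTS OF THE HISTORY (label data of the coarser levels — predictable), so the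
sensitivity of slot `i` at step `b` is GRADED: `|c b h i| ≤ C·Θ_b·κ₁^{N(h)}`, `N(h) = #{j ∈ J : h ∈ A j}`.  Product
domination of the grading events under the law of the history (`μ(⋂_{j∈S} A j) ≤ μ(Ω)∏_{j∈S} ε j`, `Σ ε ≤ E`) then
bounds the INTEGRATED squared sensitivity by `C²Θ_b²·μ(Ω)·e^{(κ₁²−1)E}` per felt slot
(`T4PathwiseCoupling.integral_pow_card_filter_le_exp` with `κ := κ₁²`). -/

section Graded

variable {Ω : Type*} {mΩ : MeasurableSpace Ω} {μ : Measure Ω} [IsFiniteMeasure μ]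
variable {ι : Type u} [Fintype ι] {J : Type*}

open scoped Classical in
/-- [folklore] **INTEGRATED GRADED SQUARED-SENSITIVITY BUDGET OF ONE STEP.**  On a finite measure space (the law of
the history): felt set `M₀`, sensitivities `c ω i` vanishing off `M₀` and graded on it by
`|c ω i| ≤ C·Θ·κ₁^{#{j ∈ Jset i : ω ∈ A i j}}` (`1 ≤ κ₁`; only squares of `C`, `Θ` enter), second moments `0 ≤ S i ≤ σ²`, grading
events product-dominated with rates `ε i j ≥ 0`, `Σ_{j ∈ Jset i} ε i j ≤ E`:
`∫ Σᵢ c ω i²·S i dμ ≤ #M₀·(C·Θ)²·σ²·μ(Ω)·exp((κ₁²−1)E)`. -/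
theorem integral_sum_sq_mul_le_of_graded (M₀ : Finset ι) {c : Ω → ι → ℝ} {S : ι → ℝ} {C Θ κ₁ σsq E : ℝ}
    (hκ₁ : 1 ≤ κ₁) (hS0 : ∀ i, 0 ≤ S i) (hSσ : ∀ i, S i ≤ σsq)
    (Jset : ι → Finset J) {A : ι → J → Set Ω} (hA : ∀ i ∈ M₀, ∀ j ∈ Jset i, MeasurableSet (A i j))
    (hc0 : ∀ ω, ∀ i ∉ M₀, c ω i = 0)
    (hcg : ∀ ω, ∀ i ∈ M₀, |c ω i| ≤ C * Θ * κ₁ ^ ((Jset i).filter fun j => ω ∈ A i j).card)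
    {ε : ι → J → ℝ} (hε : ∀ i ∈ M₀, ∀ j ∈ Jset i, 0 ≤ ε i j) (hE : ∀ i ∈ M₀, ∑ j ∈ Jset i, ε i j ≤ E)
    (hdom : ∀ i ∈ M₀, ∀ S' ⊆ Jset i, μ.real (⋂ j ∈ S', A i j) ≤ μ.real Set.univ * ∏ j ∈ S', ε i j)
    (hci : Integrable (fun ω => ∑ i, c ω i ^ 2 * S i) μ) :
    ∫ ω, ∑ i, c ω i ^ 2 * S i ∂μ ≤
      M₀.card * ((C * Θ) ^ 2 * σsq * (μ.real Set.univ * Real.exp ((κ₁ ^ 2 - 1) * E))) := by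
  have hκsq : 1 ≤ κ₁ ^ 2 := by nlinarith
  -- pointwise: Σᵢ c² S ≤ Σ_{i∈M₀} (CΘ)²σ²·(κ₁²)^{N i ω}
  have hpt : ∀ ω, ∑ i, c ω i ^ 2 * S i ≤
      ∑ i ∈ M₀, (C * Θ) ^ 2 * σsq * (κ₁ ^ 2) ^ ((Jset i).filter fun j => ω ∈ A i j).card := fun ω => by
    rw [← Finset.sum_subset (Finset.subset_univ M₀) fun i _ hi => by rw [hc0 ω i hi]; ring]
    refine Finset.sum_le_sum fun i hi => ?_
    have h1 : c ω i ^ 2 ≤ (C * Θ * κ₁ ^ ((Jset i).filter fun j => ω ∈ A i j).card) ^ 2 := by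
      rw [← sq_abs]; exact pow_le_pow_left₀ (abs_nonneg _) (hcg ω i hi) 2
    calc c ω i ^ 2 * S i ≤ (C * Θ * κ₁ ^ ((Jset i).filter fun j => ω ∈ A i j).card) ^ 2 * σsq :=
          mul_le_mul h1 (hSσ i) (hS0 i) (sq_nonneg _)
      _ = (C * Θ) ^ 2 * σsq * (κ₁ ^ 2) ^ ((Jset i).filter fun j => ω ∈ A i j).card := by ring
  have hupper : Integrable (fun ω =>
      ∑ i ∈ M₀, (C * Θ) ^ 2 * σsq * (κ₁ ^ 2) ^ ((Jset i).filter fun j => ω ∈ A i j).card) μ :=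
    integrable_finsetSum _ fun i hi => (integrable_pow_card_filter (μ := μ) (Jset i) (hA i hi) _).const_mul _
  calc ∫ ω, ∑ i, c ω i ^ 2 * S i ∂μ
      ≤ ∫ ω, ∑ i ∈ M₀, (C * Θ) ^ 2 * σsq * (κ₁ ^ 2) ^ ((Jset i).filter fun j => ω ∈ A i j).card ∂μ :=
        integral_mono hci hupper hpt
    _ = ∑ i ∈ M₀, (C * Θ) ^ 2 * σsq * ∫ ω, (κ₁ ^ 2) ^ ((Jset i).filter fun j => ω ∈ A i j).card ∂μ := by
        rw [integral_finsetSum _ fun i hi =>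
          (integrable_pow_card_filter (μ := μ) (Jset i) (hA i hi) _).const_mul _]
        exact Finset.sum_congr rfl fun i _ => integral_const_mul _ _
    _ ≤ ∑ i ∈ M₀, (C * Θ) ^ 2 * σsq * (μ.real Set.univ * Real.exp ((κ₁ ^ 2 - 1) * E)) := by
        refine Finset.sum_le_sum fun i hi => mul_le_mul_of_nonneg_left ?_
          (mul_nonneg (sq_nonneg _) ((hS0 i).trans (hSσ i)))
        refine (integral_pow_card_filter_le_exp (μ := μ) (Jset i) (hA i hi) (hε i hi) hκsq (hdom i hi)).trans
          (mul_le_mul_of_nonneg_left (Real.exp_le_exp.mpr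
            (mul_le_mul_of_nonneg_left (hE i hi) (sub_nonneg.mpr hκsq))) measureReal_nonneg)
    _ = M₀.card * ((C * Θ) ^ 2 * σsq * (μ.real Set.univ * Real.exp ((κ₁ ^ 2 - 1) * E))) := by
        rw [Finset.sum_const, nsmul_eq_mul]

end Graded

/-! ### §7(d)  END-TO-END PRIMITIVE FORM of MI-ES on the realised chain -/

section EndToEnd

variable {X : ℕ → Type*} [∀ n, MeasurableSpace (X n)]
variable {κ : (b : ℕ) → Kernel (Π i : Iic b, X i) (X (b + 1))} [∀ b, IsMarkovKernel (κ b)]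

/-- [folklore] **(c‴) MI-ES UNDER DOMINATED REPRESENTATIONS.**  As (c″) `integral_sq_sub_towerMean_le_sensitivityBudget`,
with the exact product representation replaced by a DOMINATED one of uniform slack `M₀`:
`∫ (φ − towerMean κ φ (x 0))² dμ ≤ M₀·Σ_{b<n} ∫ ½ Σᵢ c b (x≤b) i²·S b i dμ`. -/
theorem integral_sq_sub_towerMean_le_dominatedSensitivityBudget (ν : Measure (X 0)) [IsFiniteMeasure ν] (n : ℕ)
    {φ : (Π k, X k) → ℝ} (hφn : StronglyMeasurable[piLE (X := X) n] φ) {R : ℝ} (hφR : ∀ x, |φ x| ≤ R)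
    {ι : ℕ → Type u} [∀ b, Fintype (ι b)] [∀ b, DecidableEq (ι b)] {E : (b : ℕ) → ι b → Type v}
    [∀ b i, MeasurableSpace (E b i)] (π : (b : ℕ) → (i : ι b) → Measure (E b i))
    [∀ b i, IsProbabilityMeasure (π b i)]
    {T : (b : ℕ) → (Π i : Iic b, X i) → ((i : ι b) → E b i) → X (b + 1)} (hT : ∀ b h, Measurable (T b h))
    {M₀ : ℝ} (hM₀ : 0 ≤ M₀)
    (hdom : ∀ b < n, ∀ h, κ b h ≤ ENNReal.ofReal M₀ • (Measure.pi (π b)).map (T b h))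
    {c : (b : ℕ) → (Π i : Iic b, X i) → ι b → ℝ} {d : (b : ℕ) → (i : ι b) → E b i → E b i → ℝ}
    (hdi : ∀ b i a, Integrable (fun y => d b i a y ^ 2) (π b i)) {S : (b : ℕ) → ι b → ℝ}
    (hS : ∀ b i a, ∫ y, d b i a y ^ 2 ∂π b i ≤ S b i)
    (hc : ∀ b < n, ∀ h i ξ y, |fiberMean κ (b + 1) φ (succGlue b (h, T b h ξ)) -
        fiberMean κ (b + 1) φ (succGlue b (h, T b h (Function.update ξ i y)))| ≤ c b h i * d b i (ξ i) y)
    (hWm : ∀ b, StronglyMeasurable (fun h => ∑ i, c b h i ^ 2 * S b i)) {CW : ℝ}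
    (hWb : ∀ b h, |∑ i, c b h i ^ 2 * S b i| ≤ CW) :
    ∫ x, (φ x - towerMean κ φ (x 0)) ^ 2 ∂(Kernel.trajMeasure ν κ) ≤
      M₀ * ∑ b ∈ range n, ∫ x, (1 / 2 : ℝ) * ∑ i, c b (frestrictLe b x) i ^ 2 * S b i
        ∂(Kernel.trajMeasure ν κ) := by
  have hφm : StronglyMeasurable φ := hφn.mono ((piLE (X := X)).le n)
  have h1 := integral_sq_sub_towerMean_le_of_majorant (κ := κ) ν n hφn hφR
    (W := fun b h => M₀ * ((1 / 2 : ℝ) * ∑ i, c b h i ^ 2 * S b i)) (fun b => ((hWm b).const_mul _).const_mul _)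
    (CW := M₀ * ((1 / 2 : ℝ) * CW)) (fun b h => ?_) fun b hb h => ?_
  · refine h1.trans (le_of_eq ?_)
    rw [Finset.mul_sum]
    exact Finset.sum_congr rfl fun b _ => integral_const_mul _ _
  · rw [abs_mul, abs_of_nonneg hM₀, abs_mul, abs_of_nonneg (by norm_num : (0 : ℝ) ≤ 1 / 2)]
    exact mul_le_mul_of_nonneg_left (mul_le_mul_of_nonneg_left (hWb b h) (by norm_num)) hM₀
  · exact oneStepVar_le_of_dominatedRep b hφm hφR h (π b) (hT b h) hM₀ (hdom b hb h) (hdi b) (hS b) (hc b hb h)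

open scoped Classical in
/-- [folklore] **THE INTEGRATED BUDGET OF ONE STEP ON THE CHAIN from graded sensitivities** (§7(c) transported to the
law of the history `x≤b` under the path law). -/
theorem integral_sum_sq_mul_frestrictLe_le_of_graded (μ : Measure (Π n, X n)) [IsFiniteMeasure μ] (b : ℕ)
    {ι : Type u} [Fintype ι] {c : (Π i : Iic b, X i) → ι → ℝ} {S : ι → ℝ}
    (hWm : StronglyMeasurable (fun h => ∑ i, c h i ^ 2 * S i)) {CW : ℝ} (hWb : ∀ h, |∑ i, c h i ^ 2 * S i| ≤ CW)
    (Mf : Finset ι) {C Θ κ₁ σsq E : ℝ} (hκ₁ : 1 ≤ κ₁) (hS0 : ∀ i, 0 ≤ S i)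
    (hSσ : ∀ i, S i ≤ σsq) {J : Type*} (Jset : ι → Finset J) {A : ι → J → Set (Π i : Iic b, X i)}
    (hA : ∀ i ∈ Mf, ∀ j ∈ Jset i, MeasurableSet (A i j)) (hc0 : ∀ h, ∀ i ∉ Mf, c h i = 0)
    (hcg : ∀ h, ∀ i ∈ Mf, |c h i| ≤ C * Θ * κ₁ ^ ((Jset i).filter fun j => h ∈ A i j).card)
    {ε : ι → J → ℝ} (hε : ∀ i ∈ Mf, ∀ j ∈ Jset i, 0 ≤ ε i j) (hE : ∀ i ∈ Mf, ∑ j ∈ Jset i, ε i j ≤ E)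
    (hdom : ∀ i ∈ Mf, ∀ S' ⊆ Jset i,
      μ.real (⋂ j ∈ S', {x | frestrictLe b x ∈ A i j}) ≤ μ.real Set.univ * ∏ j ∈ S', ε i j) :
    ∫ x, ∑ i, c (frestrictLe b x) i ^ 2 * S i ∂μ ≤
      Mf.card * ((C * Θ) ^ 2 * σsq * (μ.real Set.univ * Real.exp ((κ₁ ^ 2 - 1) * E))) :=
  integral_sum_sq_mul_le_of_graded (μ := μ) Mf (c := fun x i => c (frestrictLe b x) i) hκ₁ hS0 hSσ Jset
    (A := fun i j => {x | frestrictLe b x ∈ A i j}) (fun i hi j hj => measurable_frestrictLe b (hA i hi j hj))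
    (fun _ i hi => hc0 _ i hi) (fun _ i hi => hcg _ i hi) hε hE hdom
    (integrable_of_abs_le_const (hWm.comp_measurable (measurable_frestrictLe b)) fun _ => hWb _)

open scoped Classical in
/-- [folklore] **MI-ES, END-TO-END PRIMITIVE FORM (realised chain).**  Inputs, ALL displayed (none printed as such,
none proved here): (i) DOMINATED PRODUCT REPRESENTATIONS of the step laws with uniform slack `M₀` (approximate
conditional independence of the resampling variables of distinct components given the history); (ii) single-innovation
sensitivities of the next effective observable with kernels `d` of second moments `S ≤ σ²`; (iii) FELT SETS `Mf b`
(`c b h i = 0` off them) and GRADED sensitivities `|c b h i| ≤ C·Θ_b·κ₁^{#irregular grading events of the history}` on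
them; (iv) PRODUCT DOMINATION of the grading events under the law of the history with level-summable rates
(`Σ ε ≤ E`).  Output: `∫ (φ − towerMean κ φ (x 0))² dμ ≤ M₀·½·C²σ²·μ(Ω)·e^{(κ₁²−1)E}·Σ_{b<n} #Mf b·Θ_b²`.
With `#Mf b ≤ P·G^b` (blocks of the loop's tube) and `Θ_b = θ^b`, `Gθ² < 1`, the last sum is `≤ P/(1 − Gθ²)`
uniformly in the depth (`integral_sq_sub_towerMean_le_of_graded_geometric`). -/
theorem integral_sq_sub_towerMean_le_of_graded (ν : Measure (X 0)) [IsFiniteMeasure ν] (n : ℕ)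
    {φ : (Π k, X k) → ℝ} (hφn : StronglyMeasurable[piLE (X := X) n] φ) {R : ℝ} (hφR : ∀ x, |φ x| ≤ R)
    {ι : ℕ → Type u} [∀ b, Fintype (ι b)] [∀ b, DecidableEq (ι b)] {E : (b : ℕ) → ι b → Type v}
    [∀ b i, MeasurableSpace (E b i)] (π : (b : ℕ) → (i : ι b) → Measure (E b i))
    [∀ b i, IsProbabilityMeasure (π b i)]
    {T : (b : ℕ) → (Π i : Iic b, X i) → ((i : ι b) → E b i) → X (b + 1)} (hT : ∀ b h, Measurable (T b h))
    {M₀ : ℝ} (hM₀ : 0 ≤ M₀)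
    (hdom : ∀ b < n, ∀ h, κ b h ≤ ENNReal.ofReal M₀ • (Measure.pi (π b)).map (T b h))
    {c : (b : ℕ) → (Π i : Iic b, X i) → ι b → ℝ} {d : (b : ℕ) → (i : ι b) → E b i → E b i → ℝ}
    (hdi : ∀ b i a, Integrable (fun y => d b i a y ^ 2) (π b i)) {S : (b : ℕ) → ι b → ℝ}
    (hS : ∀ b i a, ∫ y, d b i a y ^ 2 ∂π b i ≤ S b i)
    (hc : ∀ b < n, ∀ h i ξ y, |fiberMean κ (b + 1) φ (succGlue b (h, T b h ξ)) -
        fiberMean κ (b + 1) φ (succGlue b (h, T b h (Function.update ξ i y)))| ≤ c b h i * d b i (ξ i) y)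
    (hWm : ∀ b, StronglyMeasurable (fun h => ∑ i, c b h i ^ 2 * S b i)) {CW : ℝ}
    (hWb : ∀ b h, |∑ i, c b h i ^ 2 * S b i| ≤ CW)
    (Mf : (b : ℕ) → Finset (ι b)) {C σsq κ₁ Etot : ℝ} (hκ₁ : 1 ≤ κ₁) {Θ : ℕ → ℝ}
    (hS0 : ∀ b i, 0 ≤ S b i) (hSσ : ∀ b i, S b i ≤ σsq)
    {J : ℕ → Type*} (Jset : (b : ℕ) → ι b → Finset (J b)) {A : (b : ℕ) → ι b → J b → Set (Π i : Iic b, X i)}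
    (hA : ∀ b < n, ∀ i ∈ Mf b, ∀ j ∈ Jset b i, MeasurableSet (A b i j))
    (hc0 : ∀ b < n, ∀ h, ∀ i ∉ Mf b, c b h i = 0)
    (hcg : ∀ b < n, ∀ h, ∀ i ∈ Mf b, |c b h i| ≤ C * Θ b * κ₁ ^ ((Jset b i).filter fun j => h ∈ A b i j).card)
    {ε : (b : ℕ) → ι b → J b → ℝ} (hε : ∀ b < n, ∀ i ∈ Mf b, ∀ j ∈ Jset b i, 0 ≤ ε b i j)
    (hE : ∀ b < n, ∀ i ∈ Mf b, ∑ j ∈ Jset b i, ε b i j ≤ Etot)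
    (hdomA : ∀ b < n, ∀ i ∈ Mf b, ∀ S' ⊆ Jset b i,
      (Kernel.trajMeasure ν κ).real (⋂ j ∈ S', {x | frestrictLe b x ∈ A b i j}) ≤
        (Kernel.trajMeasure ν κ).real Set.univ * ∏ j ∈ S', ε b i j) :
    ∫ x, (φ x - towerMean κ φ (x 0)) ^ 2 ∂(Kernel.trajMeasure ν κ) ≤
      M₀ * ((1 / 2 : ℝ) * (C ^ 2 * σsq) *
        ((Kernel.trajMeasure ν κ).real Set.univ * Real.exp ((κ₁ ^ 2 - 1) * Etot)) *
          ∑ b ∈ range n, ((Mf b).card * Θ b ^ 2)) := by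
  set μ := Kernel.trajMeasure ν κ with hμ
  set K : ℝ := μ.real Set.univ * Real.exp ((κ₁ ^ 2 - 1) * Etot) with hK
  refine (integral_sq_sub_towerMean_le_dominatedSensitivityBudget (κ := κ) ν n hφn hφR π hT hM₀ hdom hdi hS hc
    hWm hWb).trans (mul_le_mul_of_nonneg_left ?_ hM₀)
  have hstep : ∀ b ∈ range n, ∫ x, (1 / 2 : ℝ) * ∑ i, c b (frestrictLe b x) i ^ 2 * S b i ∂μ ≤
      (1 / 2 : ℝ) * (C ^ 2 * σsq) * K * ((Mf b).card * Θ b ^ 2) := fun b hb => by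
    have hb' := mem_range.mp hb
    rw [integral_const_mul]
    calc (1 / 2 : ℝ) * ∫ x, ∑ i, c b (frestrictLe b x) i ^ 2 * S b i ∂μ
        ≤ (1 / 2 : ℝ) * ((Mf b).card * ((C * Θ b) ^ 2 * σsq * K)) :=
          mul_le_mul_of_nonneg_left (integral_sum_sq_mul_frestrictLe_le_of_graded μ b (hWm b) (hWb b) (Mf b)
            hκ₁ (hS0 b) (hSσ b) (Jset b) (hA b hb') (hc0 b hb') (hcg b hb') (hε b hb') (hE b hb')
            (hdomA b hb')) (by norm_num)
      _ = (1 / 2 : ℝ) * (C ^ 2 * σsq) * K * ((Mf b).card * Θ b ^ 2) := by ring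
  calc ∑ b ∈ range n, ∫ x, (1 / 2 : ℝ) * ∑ i, c b (frestrictLe b x) i ^ 2 * S b i ∂μ
      ≤ ∑ b ∈ range n, (1 / 2 : ℝ) * (C ^ 2 * σsq) * K * ((Mf b).card * Θ b ^ 2) := Finset.sum_le_sum hstep
    _ = (1 / 2 : ℝ) * (C ^ 2 * σsq) * K * ∑ b ∈ range n, ((Mf b).card * Θ b ^ 2) := by rw [Finset.mul_sum]

open scoped Classical in
/-- [folklore] **MI-ES, END-TO-END PRIMITIVE FORM with GEOMETRIC COUNTS** (`#Mf b·Θ_b² ≤ P·r^b`, `0 ≤ r < 1`): the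
ONE NUMBER is at most `M₀·½·C²σ²·ν(X 0)·e^{(κ₁²−1)E}·P/(1−r)` — free of the depth `n`.  In the dictionary
`r = L⁴θ₁² = L⁻²` (`ne1p_sqRate_nonneg_lt_one`). -/
theorem integral_sq_sub_towerMean_le_of_graded_geometric (ν : Measure (X 0)) [IsFiniteMeasure ν] (n : ℕ)
    {φ : (Π k, X k) → ℝ} (hφn : StronglyMeasurable[piLE (X := X) n] φ) {R : ℝ} (hφR : ∀ x, |φ x| ≤ R)
    {ι : ℕ → Type u} [∀ b, Fintype (ι b)] [∀ b, DecidableEq (ι b)] {E : (b : ℕ) → ι b → Type v}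
    [∀ b i, MeasurableSpace (E b i)] (π : (b : ℕ) → (i : ι b) → Measure (E b i))
    [∀ b i, IsProbabilityMeasure (π b i)]
    {T : (b : ℕ) → (Π i : Iic b, X i) → ((i : ι b) → E b i) → X (b + 1)} (hT : ∀ b h, Measurable (T b h))
    {M₀ : ℝ} (hM₀ : 0 ≤ M₀)
    (hdom : ∀ b < n, ∀ h, κ b h ≤ ENNReal.ofReal M₀ • (Measure.pi (π b)).map (T b h))
    {c : (b : ℕ) → (Π i : Iic b, X i) → ι b → ℝ} {d : (b : ℕ) → (i : ι b) → E b i → E b i → ℝ}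
    (hdi : ∀ b i a, Integrable (fun y => d b i a y ^ 2) (π b i)) {S : (b : ℕ) → ι b → ℝ}
    (hS : ∀ b i a, ∫ y, d b i a y ^ 2 ∂π b i ≤ S b i)
    (hc : ∀ b < n, ∀ h i ξ y, |fiberMean κ (b + 1) φ (succGlue b (h, T b h ξ)) -
        fiberMean κ (b + 1) φ (succGlue b (h, T b h (Function.update ξ i y)))| ≤ c b h i * d b i (ξ i) y)
    (hWm : ∀ b, StronglyMeasurable (fun h => ∑ i, c b h i ^ 2 * S b i)) {CW : ℝ}
    (hWb : ∀ b h, |∑ i, c b h i ^ 2 * S b i| ≤ CW)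
    (Mf : (b : ℕ) → Finset (ι b)) {C σsq κ₁ Etot : ℝ} (hκ₁ : 1 ≤ κ₁) {Θ : ℕ → ℝ}
    (hS0 : ∀ b i, 0 ≤ S b i) (hSσ : ∀ b i, S b i ≤ σsq)
    {J : ℕ → Type*} (Jset : (b : ℕ) → ι b → Finset (J b)) {A : (b : ℕ) → ι b → J b → Set (Π i : Iic b, X i)}
    (hA : ∀ b < n, ∀ i ∈ Mf b, ∀ j ∈ Jset b i, MeasurableSet (A b i j))
    (hc0 : ∀ b < n, ∀ h, ∀ i ∉ Mf b, c b h i = 0)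
    (hcg : ∀ b < n, ∀ h, ∀ i ∈ Mf b, |c b h i| ≤ C * Θ b * κ₁ ^ ((Jset b i).filter fun j => h ∈ A b i j).card)
    {ε : (b : ℕ) → ι b → J b → ℝ} (hε : ∀ b < n, ∀ i ∈ Mf b, ∀ j ∈ Jset b i, 0 ≤ ε b i j)
    (hE : ∀ b < n, ∀ i ∈ Mf b, ∑ j ∈ Jset b i, ε b i j ≤ Etot)
    (hdomA : ∀ b < n, ∀ i ∈ Mf b, ∀ S' ⊆ Jset b i,
      (Kernel.trajMeasure ν κ).real (⋂ j ∈ S', {x | frestrictLe b x ∈ A b i j}) ≤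
        (Kernel.trajMeasure ν κ).real Set.univ * ∏ j ∈ S', ε b i j)
    (hσ : 0 ≤ σsq) {P r : ℝ} (hP : 0 ≤ P) (hr0 : 0 ≤ r) (hr1 : r < 1)
    (hgeo : ∀ b, ((Mf b).card : ℝ) * Θ b ^ 2 ≤ P * r ^ b) :
    ∫ x, (φ x - towerMean κ φ (x 0)) ^ 2 ∂(Kernel.trajMeasure ν κ) ≤
      M₀ * ((1 / 2 : ℝ) * (C ^ 2 * σsq) * (ν.real Set.univ * Real.exp ((κ₁ ^ 2 - 1) * Etot)) *
        (P / (1 - r))) := by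
  refine (integral_sq_sub_towerMean_le_of_graded (κ := κ) ν n hφn hφR π hT hM₀ hdom hdi hS hc hWm hWb Mf hκ₁
    hS0 hSσ Jset hA hc0 hcg hε hE hdomA).trans ?_
  rw [measureReal_univ_trajMeasure (κ := κ) ν]
  refine mul_le_mul_of_nonneg_left (mul_le_mul_of_nonneg_left (sum_le_div_of_le_geometric hP hr0 hr1 hgeo n) ?_)
    hM₀
  positivity

open scoped Classical in
/-- [folklore] **NE1′ FLUCTUATION HALF FROM THE PRIMITIVES — exponential-moment form (realised chain).**  The additive
end-to-end bound `T4CouplingVariance.integral_mul_exp_le_of_condVariance` fed with the ONE NUMBER of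
`integral_sq_sub_towerMean_le_of_graded_geometric`: for `|t|·2R ≤ 1`, `B > 0`, measurable `0 ≤ g₀ ≤ Cg`,
`∫ g₀(x 0)e^{tφ} dμ ≤ e^{t²B}·∫ g₀ e^{t·towerMean κ φ} dν + e^{|t|R}·Cg·B⁻¹·(M₀·½C²σ²·ν(X 0)·e^{(κ₁²−1)E}·P/(1−r))`.
Every input is DISPLAYED; nothing printed is asserted. -/
theorem integral_mul_exp_le_of_graded_geometric (ν : Measure (X 0)) [IsFiniteMeasure ν] (n : ℕ)
    {φ : (Π k, X k) → ℝ} (hφn : StronglyMeasurable[piLE (X := X) n] φ) {R : ℝ} (hφR : ∀ x, |φ x| ≤ R)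
    {t : ℝ} (ht : |t| * (2 * R) ≤ 1) {B : ℝ} (hB : 0 < B) {g₀ : X 0 → ℝ} (hg : StronglyMeasurable g₀)
    (hg0 : ∀ z, 0 ≤ g₀ z) {Cg : ℝ} (hCg : 0 ≤ Cg) (hgC : ∀ z, g₀ z ≤ Cg)
    {ι : ℕ → Type u} [∀ b, Fintype (ι b)] [∀ b, DecidableEq (ι b)] {E : (b : ℕ) → ι b → Type v}
    [∀ b i, MeasurableSpace (E b i)] (π : (b : ℕ) → (i : ι b) → Measure (E b i))
    [∀ b i, IsProbabilityMeasure (π b i)]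
    {T : (b : ℕ) → (Π i : Iic b, X i) → ((i : ι b) → E b i) → X (b + 1)} (hT : ∀ b h, Measurable (T b h))
    {M₀ : ℝ} (hM₀ : 0 ≤ M₀)
    (hdom : ∀ b < n, ∀ h, κ b h ≤ ENNReal.ofReal M₀ • (Measure.pi (π b)).map (T b h))
    {c : (b : ℕ) → (Π i : Iic b, X i) → ι b → ℝ} {d : (b : ℕ) → (i : ι b) → E b i → E b i → ℝ}
    (hdi : ∀ b i a, Integrable (fun y => d b i a y ^ 2) (π b i)) {S : (b : ℕ) → ι b → ℝ}
    (hS : ∀ b i a, ∫ y, d b i a y ^ 2 ∂π b i ≤ S b i)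
    (hc : ∀ b < n, ∀ h i ξ y, |fiberMean κ (b + 1) φ (succGlue b (h, T b h ξ)) -
        fiberMean κ (b + 1) φ (succGlue b (h, T b h (Function.update ξ i y)))| ≤ c b h i * d b i (ξ i) y)
    (hWm : ∀ b, StronglyMeasurable (fun h => ∑ i, c b h i ^ 2 * S b i)) {CW : ℝ}
    (hWb : ∀ b h, |∑ i, c b h i ^ 2 * S b i| ≤ CW)
    (Mf : (b : ℕ) → Finset (ι b)) {C σsq κ₁ Etot : ℝ} (hκ₁ : 1 ≤ κ₁) {Θ : ℕ → ℝ}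
    (hS0 : ∀ b i, 0 ≤ S b i) (hSσ : ∀ b i, S b i ≤ σsq)
    {J : ℕ → Type*} (Jset : (b : ℕ) → ι b → Finset (J b)) {A : (b : ℕ) → ι b → J b → Set (Π i : Iic b, X i)}
    (hA : ∀ b < n, ∀ i ∈ Mf b, ∀ j ∈ Jset b i, MeasurableSet (A b i j))
    (hc0 : ∀ b < n, ∀ h, ∀ i ∉ Mf b, c b h i = 0)
    (hcg : ∀ b < n, ∀ h, ∀ i ∈ Mf b, |c b h i| ≤ C * Θ b * κ₁ ^ ((Jset b i).filter fun j => h ∈ A b i j).card)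
    {ε : (b : ℕ) → ι b → J b → ℝ} (hε : ∀ b < n, ∀ i ∈ Mf b, ∀ j ∈ Jset b i, 0 ≤ ε b i j)
    (hE : ∀ b < n, ∀ i ∈ Mf b, ∑ j ∈ Jset b i, ε b i j ≤ Etot)
    (hdomA : ∀ b < n, ∀ i ∈ Mf b, ∀ S' ⊆ Jset b i,
      (Kernel.trajMeasure ν κ).real (⋂ j ∈ S', {x | frestrictLe b x ∈ A b i j}) ≤
        (Kernel.trajMeasure ν κ).real Set.univ * ∏ j ∈ S', ε b i j)
    (hσ : 0 ≤ σsq) {P r : ℝ} (hP : 0 ≤ P) (hr0 : 0 ≤ r) (hr1 : r < 1)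
    (hgeo : ∀ b, ((Mf b).card : ℝ) * Θ b ^ 2 ≤ P * r ^ b) :
    ∫ x, g₀ (x 0) * Real.exp (t * φ x) ∂(Kernel.trajMeasure ν κ) ≤
      Real.exp (t ^ 2 * B) * ∫ z, g₀ z * Real.exp (t * towerMean κ φ z) ∂ν +
        Real.exp (|t| * R) * (Cg * (B⁻¹ * (M₀ * ((1 / 2 : ℝ) * (C ^ 2 * σsq) *
          (ν.real Set.univ * Real.exp ((κ₁ ^ 2 - 1) * Etot)) * (P / (1 - r)))))) :=
  integral_mul_exp_le_of_condVariance (κ := κ) ν n hφn hφR ht hB hg hg0 hCg hgC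
    (integral_sq_sub_towerMean_le_of_graded_geometric (κ := κ) ν n hφn hφR π hT hM₀ hdom hdi hS hc hWm hWb Mf hκ₁
      hS0 hSσ Jset hA hc0 hcg hε hE hdomA hσ hP hr0 hr1 hgeo)

open scoped Classical in
/-- [folklore] **MI-ES END-TO-END PRIMITIVE FORM — ARBITRARY PATH LAW, ANY KERNEL VERSION** (§4): `μ` a finite path
law, `κ'` any level-by-level disintegration of it (`trajMeasure_eq_of_compProd`), the §7(d) primitives stated for `κ'`
with the grading events dominated under `μ` itself:
`∫ (φ − towerMean κ' φ (x 0))² dμ ≤ M₀·½C²σ²·μ(Ω)·e^{(κ₁²−1)E}·P/(1−r)` — free of the depth `n`.  In the dictionary `μ`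
is the UNDRESSED law of the printed chain read backward level-wise and `κ'` any version of its one-step posteriors. -/
theorem integral_sq_sub_towerMean_le_of_graded_geometric_pathLaw (μ : Measure (Π n, X n)) [IsFiniteMeasure μ]
    (κ' : (b : ℕ) → Kernel (Π i : Iic b, X i) (X (b + 1))) [∀ b, IsMarkovKernel (κ' b)]
    (hκ' : ∀ b, μ.map (frestrictLe b) ⊗ₘ κ' b = μ.map (fun x => (frestrictLe b x, x (b + 1)))) (n : ℕ)
    {φ : (Π k, X k) → ℝ} (hφn : StronglyMeasurable[piLE (X := X) n] φ) {R : ℝ} (hφR : ∀ x, |φ x| ≤ R)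
    {ι : ℕ → Type u} [∀ b, Fintype (ι b)] [∀ b, DecidableEq (ι b)] {E : (b : ℕ) → ι b → Type v}
    [∀ b i, MeasurableSpace (E b i)] (π : (b : ℕ) → (i : ι b) → Measure (E b i))
    [∀ b i, IsProbabilityMeasure (π b i)]
    {T : (b : ℕ) → (Π i : Iic b, X i) → ((i : ι b) → E b i) → X (b + 1)} (hT : ∀ b h, Measurable (T b h))
    {M₀ : ℝ} (hM₀ : 0 ≤ M₀)
    (hdom : ∀ b < n, ∀ h, κ' b h ≤ ENNReal.ofReal M₀ • (Measure.pi (π b)).map (T b h))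
    {c : (b : ℕ) → (Π i : Iic b, X i) → ι b → ℝ} {d : (b : ℕ) → (i : ι b) → E b i → E b i → ℝ}
    (hdi : ∀ b i a, Integrable (fun y => d b i a y ^ 2) (π b i)) {S : (b : ℕ) → ι b → ℝ}
    (hS : ∀ b i a, ∫ y, d b i a y ^ 2 ∂π b i ≤ S b i)
    (hc : ∀ b < n, ∀ h i ξ y, |fiberMean κ' (b + 1) φ (succGlue b (h, T b h ξ)) -
        fiberMean κ' (b + 1) φ (succGlue b (h, T b h (Function.update ξ i y)))| ≤ c b h i * d b i (ξ i) y)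
    (hWm : ∀ b, StronglyMeasurable (fun h => ∑ i, c b h i ^ 2 * S b i)) {CW : ℝ}
    (hWb : ∀ b h, |∑ i, c b h i ^ 2 * S b i| ≤ CW)
    (Mf : (b : ℕ) → Finset (ι b)) {C σsq κ₁ Etot : ℝ} (hκ₁ : 1 ≤ κ₁) {Θ : ℕ → ℝ}
    (hS0 : ∀ b i, 0 ≤ S b i) (hSσ : ∀ b i, S b i ≤ σsq)
    {J : ℕ → Type*} (Jset : (b : ℕ) → ι b → Finset (J b)) {A : (b : ℕ) → ι b → J b → Set (Π i : Iic b, X i)}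
    (hA : ∀ b < n, ∀ i ∈ Mf b, ∀ j ∈ Jset b i, MeasurableSet (A b i j))
    (hc0 : ∀ b < n, ∀ h, ∀ i ∉ Mf b, c b h i = 0)
    (hcg : ∀ b < n, ∀ h, ∀ i ∈ Mf b, |c b h i| ≤ C * Θ b * κ₁ ^ ((Jset b i).filter fun j => h ∈ A b i j).card)
    {ε : (b : ℕ) → ι b → J b → ℝ} (hε : ∀ b < n, ∀ i ∈ Mf b, ∀ j ∈ Jset b i, 0 ≤ ε b i j)
    (hE : ∀ b < n, ∀ i ∈ Mf b, ∑ j ∈ Jset b i, ε b i j ≤ Etot)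
    (hdomA : ∀ b < n, ∀ i ∈ Mf b, ∀ S' ⊆ Jset b i,
      μ.real (⋂ j ∈ S', {x | frestrictLe b x ∈ A b i j}) ≤
        μ.real Set.univ * ∏ j ∈ S', ε b i j)
    (hσ : 0 ≤ σsq) {P r : ℝ} (hP : 0 ≤ P) (hr0 : 0 ≤ r) (hr1 : r < 1)
    (hgeo : ∀ b, ((Mf b).card : ℝ) * Θ b ^ 2 ≤ P * r ^ b) :
    ∫ x, (φ x - towerMean κ' φ (x 0)) ^ 2 ∂μ ≤
      M₀ * ((1 / 2 : ℝ) * (C ^ 2 * σsq) * (μ.real Set.univ * Real.exp ((κ₁ ^ 2 - 1) * Etot)) *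
        (P / (1 - r))) := by
  have hμ := trajMeasure_eq_of_compProd μ κ' hκ'
  have h := integral_sq_sub_towerMean_le_of_graded_geometric (κ := κ') (μ.map (fun x => x 0)) n hφn hφR π hT hM₀
    hdom hdi hS hc hWm hWb Mf hκ₁ hS0 hSσ Jset hA hc0 hcg hε hE (by rw [hμ]; exact hdomA) hσ hP hr0 hr1 hgeo
  rw [hμ, map_measureReal_apply (measurable_pi_apply 0) MeasurableSet.univ, Set.preimage_univ] at h
  exact h

end EndToEnd

/-! ## §8  LOCALISED DOMINATION (v3, append-only): the slack is the density ratio of the FELT MARGINAL only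

§7's `hdom : κ b h ≤ M•(⊗ᵢπᵢ).map T` dominates the WHOLE step law by the product reference; for a Gibbs tilt by a
non-local interaction of total size `u` this gives `M = e^{2u}` with `u` growing with the volume.  The Efron–Stein
bound of a step, however, only integrates a function of the FELT innovations (those the next effective observable
depends on — a finite set `F` fixed by the loop's tube), so only the density ratio of the `F`-MARGINALS enters.
§8(a) factors the end-to-end chain of §7(d) through an abstract per-step budget `hstep`; §8(b) proves the pointwise
step bound from a representation `κ b h = Q.map T` by an ARBITRARY innovation law `Q` whose `F`-marginal is
dominated, `Q.map F.restrict ≤ M•(⊗ᵢπᵢ).map F.restrict`, and `F`-locality of the next effective observable;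
§8(c) assembles the end-to-end primitive form with marginal slack.  In the dictionary `M = M_F(h)` is controlled by
the linking terms of the effective action that touch the felt components — a volume-free quantity — which is what
print's decoupling / polymer expansion is to be asked for (record MI-ES (ES-rep), robust form). -/

/-! ### §8(a)  The end-to-end chain through an abstract per-step budget -/

section StepBudget

variable {X : ℕ → Type*} [∀ n, MeasurableSpace (X n)]
variable {κ : (b : ℕ) → Kernel (Π i : Iic b, X i) (X (b + 1))} [∀ b, IsMarkovKernel (κ b)]

/-- [folklore] **FROM A PER-STEP SENSITIVITY BUDGET TO THE INTEGRATED BUDGET.**  If at every step `b < n` and every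
history `h` the one-step variance is bounded by `M₀·½Σᵢ c b h i²·S b i` (however obtained: exact, dominated or
marginally dominated product representation), with the budget measurable and bounded in `h`, then
`∫ (φ − towerMean κ φ (x 0))² dμ ≤ M₀·Σ_{b<n} ∫ ½Σᵢ c b (x≤b) i²·S b i dμ`. -/
theorem integral_sq_sub_towerMean_le_of_stepBudget (ν : Measure (X 0)) [IsFiniteMeasure ν] (n : ℕ)
    {φ : (Π k, X k) → ℝ} (hφn : StronglyMeasurable[piLE (X := X) n] φ) {R : ℝ} (hφR : ∀ x, |φ x| ≤ R)
    {ι : ℕ → Type u} [∀ b, Fintype (ι b)] {M₀ : ℝ} (hM₀ : 0 ≤ M₀)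
    {c : (b : ℕ) → (Π i : Iic b, X i) → ι b → ℝ} {S : (b : ℕ) → ι b → ℝ}
    (hstep : ∀ b < n, ∀ h, oneStepVar κ b φ h ≤ M₀ * ((1 / 2 : ℝ) * ∑ i, c b h i ^ 2 * S b i))
    (hWm : ∀ b, StronglyMeasurable (fun h => ∑ i, c b h i ^ 2 * S b i)) {CW : ℝ}
    (hWb : ∀ b h, |∑ i, c b h i ^ 2 * S b i| ≤ CW) :
    ∫ x, (φ x - towerMean κ φ (x 0)) ^ 2 ∂(Kernel.trajMeasure ν κ) ≤
      M₀ * ∑ b ∈ range n, ∫ x, (1 / 2 : ℝ) * ∑ i, c b (frestrictLe b x) i ^ 2 * S b i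
        ∂(Kernel.trajMeasure ν κ) := by
  have h1 := integral_sq_sub_towerMean_le_of_majorant (κ := κ) ν n hφn hφR
    (W := fun b h => M₀ * ((1 / 2 : ℝ) * ∑ i, c b h i ^ 2 * S b i)) (fun b => ((hWm b).const_mul _).const_mul _)
    (CW := M₀ * ((1 / 2 : ℝ) * CW)) (fun b h => ?_) hstep
  · refine h1.trans (le_of_eq ?_)
    rw [Finset.mul_sum]
    exact Finset.sum_congr rfl fun b _ => integral_const_mul _ _
  · rw [abs_mul, abs_of_nonneg hM₀, abs_mul, abs_of_nonneg (by norm_num : (0 : ℝ) ≤ 1 / 2)]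
    exact mul_le_mul_of_nonneg_left (mul_le_mul_of_nonneg_left (hWb b h) (by norm_num)) hM₀

open scoped Classical in
/-- [folklore] **FROM A PER-STEP SENSITIVITY BUDGET TO THE ONE NUMBER** (graded sensitivities on felt sets with
geometric counts, product-dominated irregularity events; the §7(d) chain with the representation step abstracted
into `hstep`): `∫ (φ − towerMean)² dμ ≤ M₀·½C²σ²·ν(X 0)·e^{(κ₁²−1)E}·P/(1−r)`. -/
theorem integral_sq_sub_towerMean_le_of_stepBudget_graded_geometric (ν : Measure (X 0)) [IsFiniteMeasure ν]
    (n : ℕ) {φ : (Π k, X k) → ℝ} (hφn : StronglyMeasurable[piLE (X := X) n] φ) {R : ℝ} (hφR : ∀ x, |φ x| ≤ R)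
    {ι : ℕ → Type u} [∀ b, Fintype (ι b)] {M₀ : ℝ} (hM₀ : 0 ≤ M₀)
    {c : (b : ℕ) → (Π i : Iic b, X i) → ι b → ℝ} {S : (b : ℕ) → ι b → ℝ}
    (hstep : ∀ b < n, ∀ h, oneStepVar κ b φ h ≤ M₀ * ((1 / 2 : ℝ) * ∑ i, c b h i ^ 2 * S b i))
    (hWm : ∀ b, StronglyMeasurable (fun h => ∑ i, c b h i ^ 2 * S b i)) {CW : ℝ}
    (hWb : ∀ b h, |∑ i, c b h i ^ 2 * S b i| ≤ CW)
    (Mf : (b : ℕ) → Finset (ι b)) {C σsq κ₁ Etot : ℝ} (hκ₁ : 1 ≤ κ₁) {Θ : ℕ → ℝ}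
    (hS0 : ∀ b i, 0 ≤ S b i) (hSσ : ∀ b i, S b i ≤ σsq)
    {J : ℕ → Type*} (Jset : (b : ℕ) → ι b → Finset (J b)) {A : (b : ℕ) → ι b → J b → Set (Π i : Iic b, X i)}
    (hA : ∀ b < n, ∀ i ∈ Mf b, ∀ j ∈ Jset b i, MeasurableSet (A b i j))
    (hc0 : ∀ b < n, ∀ h, ∀ i ∉ Mf b, c b h i = 0)
    (hcg : ∀ b < n, ∀ h, ∀ i ∈ Mf b, |c b h i| ≤ C * Θ b * κ₁ ^ ((Jset b i).filter fun j => h ∈ A b i j).card)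
    {ε : (b : ℕ) → ι b → J b → ℝ} (hε : ∀ b < n, ∀ i ∈ Mf b, ∀ j ∈ Jset b i, 0 ≤ ε b i j)
    (hE : ∀ b < n, ∀ i ∈ Mf b, ∑ j ∈ Jset b i, ε b i j ≤ Etot)
    (hdomA : ∀ b < n, ∀ i ∈ Mf b, ∀ S' ⊆ Jset b i,
      (Kernel.trajMeasure ν κ).real (⋂ j ∈ S', {x | frestrictLe b x ∈ A b i j}) ≤
        (Kernel.trajMeasure ν κ).real Set.univ * ∏ j ∈ S', ε b i j)
    (hσ : 0 ≤ σsq) {P r : ℝ} (hP : 0 ≤ P) (hr0 : 0 ≤ r) (hr1 : r < 1)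
    (hgeo : ∀ b, ((Mf b).card : ℝ) * Θ b ^ 2 ≤ P * r ^ b) :
    ∫ x, (φ x - towerMean κ φ (x 0)) ^ 2 ∂(Kernel.trajMeasure ν κ) ≤
      M₀ * ((1 / 2 : ℝ) * (C ^ 2 * σsq) * (ν.real Set.univ * Real.exp ((κ₁ ^ 2 - 1) * Etot)) *
        (P / (1 - r))) := by
  set μ := Kernel.trajMeasure ν κ with hμ
  set K : ℝ := μ.real Set.univ * Real.exp ((κ₁ ^ 2 - 1) * Etot) with hK
  refine (integral_sq_sub_towerMean_le_of_stepBudget (κ := κ) ν n hφn hφR hM₀ hstep hWm hWb).trans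
    (mul_le_mul_of_nonneg_left ?_ hM₀)
  have hstep' : ∀ b ∈ range n, ∫ x, (1 / 2 : ℝ) * ∑ i, c b (frestrictLe b x) i ^ 2 * S b i ∂μ ≤
      (1 / 2 : ℝ) * (C ^ 2 * σsq) * K * ((Mf b).card * Θ b ^ 2) := fun b hb => by
    have hb' := mem_range.mp hb
    rw [integral_const_mul]
    calc (1 / 2 : ℝ) * ∫ x, ∑ i, c b (frestrictLe b x) i ^ 2 * S b i ∂μ
        ≤ (1 / 2 : ℝ) * ((Mf b).card * ((C * Θ b) ^ 2 * σsq * K)) :=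
          mul_le_mul_of_nonneg_left (integral_sum_sq_mul_frestrictLe_le_of_graded μ b (hWm b) (hWb b) (Mf b)
            hκ₁ (hS0 b) (hSσ b) (Jset b) (hA b hb') (hc0 b hb') (hcg b hb') (hε b hb') (hE b hb')
            (hdomA b hb')) (by norm_num)
      _ = (1 / 2 : ℝ) * (C ^ 2 * σsq) * K * ((Mf b).card * Θ b ^ 2) := by ring
  have hsum : ∑ b ∈ range n, ((Mf b).card : ℝ) * Θ b ^ 2 ≤ P / (1 - r) :=
    sum_le_div_of_le_geometric hP hr0 hr1 hgeo n
  have hK0 : 0 ≤ (1 / 2 : ℝ) * (C ^ 2 * σsq) * K := by positivity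
  calc ∑ b ∈ range n, ∫ x, (1 / 2 : ℝ) * ∑ i, c b (frestrictLe b x) i ^ 2 * S b i ∂μ
      ≤ ∑ b ∈ range n, (1 / 2 : ℝ) * (C ^ 2 * σsq) * K * ((Mf b).card * Θ b ^ 2) := Finset.sum_le_sum hstep'
    _ = (1 / 2 : ℝ) * (C ^ 2 * σsq) * K * ∑ b ∈ range n, ((Mf b).card * Θ b ^ 2) := by rw [Finset.mul_sum]
    _ ≤ (1 / 2 : ℝ) * (C ^ 2 * σsq) * K * (P / (1 - r)) := mul_le_mul_of_nonneg_left hsum hK0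
    _ = (1 / 2 : ℝ) * (C ^ 2 * σsq) * (ν.real Set.univ * Real.exp ((κ₁ ^ 2 - 1) * Etot)) * (P / (1 - r)) := by
          rw [hK, hμ, measureReal_univ_trajMeasure (κ := κ) ν]

end StepBudget

/-! ### §8(b)  ONE-STEP INCOHERENCE under a MARGINALLY DOMINATED representation -/

section MarginalRep

variable {X : ℕ → Type*} [∀ n, MeasurableSpace (X n)]
variable {κ : (b : ℕ) → Kernel (Π i : Iic b, X i) (X (b + 1))} [∀ b, IsMarkovKernel (κ b)]
variable {ι : Type u} [Fintype ι] [DecidableEq ι] {E : ι → Type v} [∀ i, MeasurableSpace (E i)]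

/-- [folklore] **ONE-STEP INCOHERENCE WITH MARGINAL SLACK.**  Let the step law at the history `h` be the image
`κ b h = Q.map T` of an ARBITRARY probability law `Q` on the innovation space (no product structure), let `F` be a
finite FELT SET such that the next effective observable `g ξ = fiberMean κ (b+1) φ (succGlue b (h, T ξ))` depends on
`ξ` only through `(ξᵢ)_{i∈F}` (`hloc`), and let the `F`-MARGINAL of `Q` be dominated by `M` times the `F`-marginal of a
product reference law, `Q.map F.restrict ≤ M•(⊗ᵢπᵢ).map F.restrict`.  Then single-innovation sensitivities
`|g ξ − g (ξ with ξᵢ := y)| ≤ cᵢ·dᵢ(ξᵢ, y)`, `∫ dᵢ(a,·)² dπᵢ ≤ Sᵢ`, give `oneStepVar κ b φ h ≤ M·½Σᵢ cᵢ²·Sᵢ`.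
Only the density ratio of the FELT marginals enters — in the dictionary a quantity controlled by the linking terms
of the effective action touching the felt components, free of the volume. -/
theorem oneStepVar_le_of_marginalDominatedRep (b : ℕ) {φ : (Π n, X n) → ℝ} (hφm : StronglyMeasurable φ)
    {R : ℝ} (hφR : ∀ x, |φ x| ≤ R) (h : Π i : Iic b, X i) (π : (i : ι) → Measure (E i))
    [∀ i, IsProbabilityMeasure (π i)] {T : ((i : ι) → E i) → X (b + 1)} (hT : Measurable T)
    (Q : Measure ((i : ι) → E i)) [IsProbabilityMeasure Q] (hrep : κ b h = Q.map T)
    (F : Finset ι) {M : ℝ} (hM : 0 ≤ M)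
    (hdomF : Q.map F.restrict ≤ ENNReal.ofReal M • (Measure.pi π).map F.restrict)
    (hloc : ∀ ξ ξ' : (i : ι) → E i, (∀ i ∈ F, ξ i = ξ' i) →
      fiberMean κ (b + 1) φ (succGlue b (h, T ξ)) = fiberMean κ (b + 1) φ (succGlue b (h, T ξ')))
    {c : ι → ℝ} {d : (i : ι) → E i → E i → ℝ}
    (hdi : ∀ i a, Integrable (fun y => d i a y ^ 2) (π i)) {S : ι → ℝ}
    (hS : ∀ i a, ∫ y, d i a y ^ 2 ∂π i ≤ S i)
    (hc : ∀ i ξ y, |fiberMean κ (b + 1) φ (succGlue b (h, T ξ)) -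
        fiberMean κ (b + 1) φ (succGlue b (h, T (Function.update ξ i y)))| ≤ c i * d i (ξ i) y) :
    oneStepVar κ b φ h ≤ M * ((1 / 2 : ℝ) * ∑ i, c i ^ 2 * S i) := by
  -- the next effective observable on the next level and on the innovation space
  set g : X (b + 1) → ℝ := fun y => fiberMean κ (b + 1) φ (succGlue b (h, y)) with hg
  have hgm : StronglyMeasurable g :=
    (stronglyMeasurable_fiberMean _ hφm).comp_measurable (measurable_succGlue_mk b h)
  have hGm : Measurable (fun ξ => g (T ξ)) := hgm.measurable.comp hT
  have hGb : ∀ ξ, |g (T ξ)| ≤ R := fun ξ => abs_fiberMean_le _ hφm hφR _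
  -- the innovation space is nonempty (it carries a probability law); fix a base point and the extension map
  have hne : Nonempty ((i : ι) → E i) := by
    by_contra hc'
    rw [not_nonempty_iff] at hc'
    have h1 : Q Set.univ = 1 := measure_univ
    rw [Set.univ_eq_empty_iff.mpr hc', measure_empty] at h1
    exact zero_ne_one h1
  obtain ⟨ξ₀⟩ := hne
  set ext : ((i : F) → E i) → ((i : ι) → E i) := fun η i => if hi : i ∈ F then η ⟨i, hi⟩ else ξ₀ i with hext
  have hext_m : Measurable ext := by
    refine measurable_pi_lambda _ fun i => ?_
    by_cases hi : i ∈ F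
    · simp only [hext, dif_pos hi]; exact measurable_pi_apply _
    · simp only [hext, dif_neg hi]; exact measurable_const
  have hGext : ∀ ξ, g (T ξ) = g (T (ext (F.restrict ξ))) := fun ξ =>
    hloc ξ _ fun i hi => by simp only [hext, dif_pos hi, Finset.restrict]
  -- centring constant and the function of the felt coordinates
  set a : ℝ := ∫ ζ, g (T ζ) ∂Measure.pi π with ha
  set GF : ((i : F) → E i) → ℝ := fun η => (g (T (ext η)) - a) ^ 2 with hGF
  have hGFm : Measurable GF := ((hGm.comp hext_m).sub measurable_const).pow_const 2
  have hGFb : ∀ η, |GF η| ≤ (R + |a|) ^ 2 := fun η => by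
    rw [hGF]; dsimp only
    rw [abs_of_nonneg (sq_nonneg _), ← sq_abs]
    exact pow_le_pow_left₀ (abs_nonneg _) ((abs_sub _ _).trans (add_le_add (hGb _) le_rfl)) 2
  have hcomp : ∀ ξ, (g (T ξ) - a) ^ 2 = GF (F.restrict ξ) := fun ξ => by
    rw [hGF]; dsimp only; rw [← hGext ξ]
  have htrans : ∀ ρ : Measure ((i : ι) → E i),
      ∫ ξ, (g (T ξ) - a) ^ 2 ∂ρ = ∫ η, GF η ∂(ρ.map F.restrict) := fun ρ => by
    rw [integral_map (Finset.measurable_restrict F).aemeasurable hGFm.aestronglyMeasurable]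
    exact integral_congr_ae (ae_of_all _ fun ξ => hcomp ξ)
  -- step 1: one-step variance ≤ second moment about `a` under the step law = under Q
  have h1 : oneStepVar κ b φ h ≤ ∫ ξ, (g (T ξ) - a) ^ 2 ∂Q := by
    have h1' := oneStepVar_le_integral_kernel_sq_sub_const (κ := κ) b hφm hφR h a
    rw [hrep, integral_map hT.aemeasurable] at h1'
    · exact h1'
    · exact ((hgm.measurable.sub measurable_const).pow_const 2).aestronglyMeasurable
  -- step 2: only the felt marginal enters; dominate it
  have hfin : IsFiniteMeasure ((Measure.pi π).map F.restrict) := inferInstance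
  have h2 : ∫ η, GF η ∂(Q.map F.restrict) ≤ M * ∫ η, GF η ∂((Measure.pi π).map F.restrict) :=
    integral_le_mul_of_dominated hM hdomF (fun η => sq_nonneg _)
      (integrable_of_abs_le_const hGFm.stronglyMeasurable hGFb)
  -- step 3: Efron–Stein under the product reference
  have h3 : ∫ ξ, (g (T ξ) - a) ^ 2 ∂Measure.pi π ≤ (1 / 2 : ℝ) * ∑ i, c i ^ 2 * S i :=
    integral_sq_sub_integral_le_sum_sensitivity π hGm hGb hdi hS hc
  calc oneStepVar κ b φ h ≤ ∫ ξ, (g (T ξ) - a) ^ 2 ∂Q := h1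
    _ = ∫ η, GF η ∂(Q.map F.restrict) := htrans Q
    _ ≤ M * ∫ η, GF η ∂((Measure.pi π).map F.restrict) := h2
    _ = M * ∫ ξ, (g (T ξ) - a) ^ 2 ∂Measure.pi π := by rw [← htrans]
    _ ≤ M * ((1 / 2 : ℝ) * ∑ i, c i ^ 2 * S i) := mul_le_mul_of_nonneg_left h3 hM

omit [∀ b, IsMarkovKernel (κ b)] [DecidableEq ι] in
/-- [folklore] Global domination of a representing law implies domination of every marginal (§7 is the special
case `Q := ⊗ᵢπᵢ`-dominated globally; the converse fails, which is the point of §8). -/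
theorem map_restrict_le_of_le (Q : Measure ((i : ι) → E i)) (π : (i : ι) → Measure (E i)) (F : Finset ι)
    {M : ℝ≥0∞} (hdom : Q ≤ M • Measure.pi π) :
    Q.map F.restrict ≤ M • (Measure.pi π).map F.restrict := by
  rw [← Measure.map_smul]
  exact Measure.map_mono hdom (Finset.measurable_restrict F)

end MarginalRep

/-! ### §8(c)  MI-ES, END-TO-END PRIMITIVE FORM with MARGINAL slack -/

section EndToEndMarginal

variable {X : ℕ → Type*} [∀ n, MeasurableSpace (X n)]
variable {κ : (b : ℕ) → Kernel (Π i : Iic b, X i) (X (b + 1))} [∀ b, IsMarkovKernel (κ b)]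

open scoped Classical in
/-- [folklore] **MI-ES, END-TO-END PRIMITIVE FORM, MARGINAL SLACK (realised chain).**  As
`integral_sq_sub_towerMean_le_of_graded_geometric`, but the step laws are images `κ b h = (Q b h).map (T b h)` of
ARBITRARY innovation laws whose FELT marginals (felt sets `Mf b`) are dominated by `M₀` times those of the product
references, and the next effective observables are `Mf b`-local:
`∫ (φ − towerMean)² dμ ≤ M₀·½C²σ²·ν(X 0)·e^{(κ₁²−1)E}·P/(1−r)`. -/
theorem integral_sq_sub_towerMean_le_of_graded_geometric_marginal (ν : Measure (X 0)) [IsFiniteMeasure ν] (n : ℕ)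
    {φ : (Π k, X k) → ℝ} (hφn : StronglyMeasurable[piLE (X := X) n] φ) {R : ℝ} (hφR : ∀ x, |φ x| ≤ R)
    {ι : ℕ → Type u} [∀ b, Fintype (ι b)] [∀ b, DecidableEq (ι b)] {E : (b : ℕ) → ι b → Type v}
    [∀ b i, MeasurableSpace (E b i)] (π : (b : ℕ) → (i : ι b) → Measure (E b i))
    [∀ b i, IsProbabilityMeasure (π b i)]
    {T : (b : ℕ) → (Π i : Iic b, X i) → ((i : ι b) → E b i) → X (b + 1)} (hT : ∀ b h, Measurable (T b h))
    (Q : (b : ℕ) → (Π i : Iic b, X i) → Measure ((i : ι b) → E b i)) [∀ b h, IsProbabilityMeasure (Q b h)]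
    (hrep : ∀ b < n, ∀ h, κ b h = (Q b h).map (T b h))
    (Mf : (b : ℕ) → Finset (ι b)) {M₀ : ℝ} (hM₀ : 0 ≤ M₀)
    (hdomF : ∀ b < n, ∀ h,
      (Q b h).map (Mf b).restrict ≤ ENNReal.ofReal M₀ • (Measure.pi (π b)).map (Mf b).restrict)
    (hloc : ∀ b < n, ∀ h, ∀ ξ ξ' : (i : ι b) → E b i, (∀ i ∈ Mf b, ξ i = ξ' i) →
      fiberMean κ (b + 1) φ (succGlue b (h, T b h ξ)) = fiberMean κ (b + 1) φ (succGlue b (h, T b h ξ')))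
    {c : (b : ℕ) → (Π i : Iic b, X i) → ι b → ℝ} {d : (b : ℕ) → (i : ι b) → E b i → E b i → ℝ}
    (hdi : ∀ b i a, Integrable (fun y => d b i a y ^ 2) (π b i)) {S : (b : ℕ) → ι b → ℝ}
    (hS : ∀ b i a, ∫ y, d b i a y ^ 2 ∂π b i ≤ S b i)
    (hc : ∀ b < n, ∀ h i ξ y, |fiberMean κ (b + 1) φ (succGlue b (h, T b h ξ)) -
        fiberMean κ (b + 1) φ (succGlue b (h, T b h (Function.update ξ i y)))| ≤ c b h i * d b i (ξ i) y)
    (hWm : ∀ b, StronglyMeasurable (fun h => ∑ i, c b h i ^ 2 * S b i)) {CW : ℝ}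
    (hWb : ∀ b h, |∑ i, c b h i ^ 2 * S b i| ≤ CW)
    {C σsq κ₁ Etot : ℝ} (hκ₁ : 1 ≤ κ₁) {Θ : ℕ → ℝ}
    (hS0 : ∀ b i, 0 ≤ S b i) (hSσ : ∀ b i, S b i ≤ σsq)
    {J : ℕ → Type*} (Jset : (b : ℕ) → ι b → Finset (J b)) {A : (b : ℕ) → ι b → J b → Set (Π i : Iic b, X i)}
    (hA : ∀ b < n, ∀ i ∈ Mf b, ∀ j ∈ Jset b i, MeasurableSet (A b i j))
    (hc0 : ∀ b < n, ∀ h, ∀ i ∉ Mf b, c b h i = 0)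
    (hcg : ∀ b < n, ∀ h, ∀ i ∈ Mf b, |c b h i| ≤ C * Θ b * κ₁ ^ ((Jset b i).filter fun j => h ∈ A b i j).card)
    {ε : (b : ℕ) → ι b → J b → ℝ} (hε : ∀ b < n, ∀ i ∈ Mf b, ∀ j ∈ Jset b i, 0 ≤ ε b i j)
    (hE : ∀ b < n, ∀ i ∈ Mf b, ∑ j ∈ Jset b i, ε b i j ≤ Etot)
    (hdomA : ∀ b < n, ∀ i ∈ Mf b, ∀ S' ⊆ Jset b i,
      (Kernel.trajMeasure ν κ).real (⋂ j ∈ S', {x | frestrictLe b x ∈ A b i j}) ≤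
        (Kernel.trajMeasure ν κ).real Set.univ * ∏ j ∈ S', ε b i j)
    (hσ : 0 ≤ σsq) {P r : ℝ} (hP : 0 ≤ P) (hr0 : 0 ≤ r) (hr1 : r < 1)
    (hgeo : ∀ b, ((Mf b).card : ℝ) * Θ b ^ 2 ≤ P * r ^ b) :
    ∫ x, (φ x - towerMean κ φ (x 0)) ^ 2 ∂(Kernel.trajMeasure ν κ) ≤
      M₀ * ((1 / 2 : ℝ) * (C ^ 2 * σsq) * (ν.real Set.univ * Real.exp ((κ₁ ^ 2 - 1) * Etot)) *
        (P / (1 - r))) := by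
  have hφm : StronglyMeasurable φ := hφn.mono ((piLE (X := X)).le n)
  exact integral_sq_sub_towerMean_le_of_stepBudget_graded_geometric (κ := κ) ν n hφn hφR hM₀
    (fun b hb h => oneStepVar_le_of_marginalDominatedRep b hφm hφR h (π b) (hT b h) (Q b h) (hrep b hb h) (Mf b)
      hM₀ (hdomF b hb h) (hloc b hb h) (hdi b) (hS b) (hc b hb h))
    hWm hWb Mf hκ₁ hS0 hSσ Jset hA hc0 hcg hε hE hdomA hσ hP hr0 hr1 hgeo

open scoped Classical in
/-- [folklore] **MI-ES, END-TO-END PRIMITIVE FORM, MARGINAL SLACK — arbitrary path law, any kernel version.** -/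
theorem integral_sq_sub_towerMean_le_of_graded_geometric_marginal_pathLaw (μ : Measure (Π n, X n))
    [IsFiniteMeasure μ] (κ' : (b : ℕ) → Kernel (Π i : Iic b, X i) (X (b + 1))) [∀ b, IsMarkovKernel (κ' b)]
    (hκ' : ∀ b, μ.map (frestrictLe b) ⊗ₘ κ' b = μ.map (fun x => (frestrictLe b x, x (b + 1)))) (n : ℕ)
    {φ : (Π k, X k) → ℝ} (hφn : StronglyMeasurable[piLE (X := X) n] φ) {R : ℝ} (hφR : ∀ x, |φ x| ≤ R)
    {ι : ℕ → Type u} [∀ b, Fintype (ι b)] [∀ b, DecidableEq (ι b)] {E : (b : ℕ) → ι b → Type v}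
    [∀ b i, MeasurableSpace (E b i)] (π : (b : ℕ) → (i : ι b) → Measure (E b i))
    [∀ b i, IsProbabilityMeasure (π b i)]
    {T : (b : ℕ) → (Π i : Iic b, X i) → ((i : ι b) → E b i) → X (b + 1)} (hT : ∀ b h, Measurable (T b h))
    (Q : (b : ℕ) → (Π i : Iic b, X i) → Measure ((i : ι b) → E b i)) [∀ b h, IsProbabilityMeasure (Q b h)]
    (hrep : ∀ b < n, ∀ h, κ' b h = (Q b h).map (T b h))
    (Mf : (b : ℕ) → Finset (ι b)) {M₀ : ℝ} (hM₀ : 0 ≤ M₀)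
    (hdomF : ∀ b < n, ∀ h,
      (Q b h).map (Mf b).restrict ≤ ENNReal.ofReal M₀ • (Measure.pi (π b)).map (Mf b).restrict)
    (hloc : ∀ b < n, ∀ h, ∀ ξ ξ' : (i : ι b) → E b i, (∀ i ∈ Mf b, ξ i = ξ' i) →
      fiberMean κ' (b + 1) φ (succGlue b (h, T b h ξ)) = fiberMean κ' (b + 1) φ (succGlue b (h, T b h ξ')))
    {c : (b : ℕ) → (Π i : Iic b, X i) → ι b → ℝ} {d : (b : ℕ) → (i : ι b) → E b i → E b i → ℝ}
    (hdi : ∀ b i a, Integrable (fun y => d b i a y ^ 2) (π b i)) {S : (b : ℕ) → ι b → ℝ}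
    (hS : ∀ b i a, ∫ y, d b i a y ^ 2 ∂π b i ≤ S b i)
    (hc : ∀ b < n, ∀ h i ξ y, |fiberMean κ' (b + 1) φ (succGlue b (h, T b h ξ)) -
        fiberMean κ' (b + 1) φ (succGlue b (h, T b h (Function.update ξ i y)))| ≤ c b h i * d b i (ξ i) y)
    (hWm : ∀ b, StronglyMeasurable (fun h => ∑ i, c b h i ^ 2 * S b i)) {CW : ℝ}
    (hWb : ∀ b h, |∑ i, c b h i ^ 2 * S b i| ≤ CW)
    {C σsq κ₁ Etot : ℝ} (hκ₁ : 1 ≤ κ₁) {Θ : ℕ → ℝ}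
    (hS0 : ∀ b i, 0 ≤ S b i) (hSσ : ∀ b i, S b i ≤ σsq)
    {J : ℕ → Type*} (Jset : (b : ℕ) → ι b → Finset (J b)) {A : (b : ℕ) → ι b → J b → Set (Π i : Iic b, X i)}
    (hA : ∀ b < n, ∀ i ∈ Mf b, ∀ j ∈ Jset b i, MeasurableSet (A b i j))
    (hc0 : ∀ b < n, ∀ h, ∀ i ∉ Mf b, c b h i = 0)
    (hcg : ∀ b < n, ∀ h, ∀ i ∈ Mf b, |c b h i| ≤ C * Θ b * κ₁ ^ ((Jset b i).filter fun j => h ∈ A b i j).card)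
    {ε : (b : ℕ) → ι b → J b → ℝ} (hε : ∀ b < n, ∀ i ∈ Mf b, ∀ j ∈ Jset b i, 0 ≤ ε b i j)
    (hE : ∀ b < n, ∀ i ∈ Mf b, ∑ j ∈ Jset b i, ε b i j ≤ Etot)
    (hdomA : ∀ b < n, ∀ i ∈ Mf b, ∀ S' ⊆ Jset b i,
      μ.real (⋂ j ∈ S', {x | frestrictLe b x ∈ A b i j}) ≤ μ.real Set.univ * ∏ j ∈ S', ε b i j)
    (hσ : 0 ≤ σsq) {P r : ℝ} (hP : 0 ≤ P) (hr0 : 0 ≤ r) (hr1 : r < 1)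
    (hgeo : ∀ b, ((Mf b).card : ℝ) * Θ b ^ 2 ≤ P * r ^ b) :
    ∫ x, (φ x - towerMean κ' φ (x 0)) ^ 2 ∂μ ≤
      M₀ * ((1 / 2 : ℝ) * (C ^ 2 * σsq) * (μ.real Set.univ * Real.exp ((κ₁ ^ 2 - 1) * Etot)) *
        (P / (1 - r))) := by
  have hμ := trajMeasure_eq_of_compProd μ κ' hκ'
  have h := integral_sq_sub_towerMean_le_of_graded_geometric_marginal (κ := κ') (μ.map (fun x => x 0)) n hφn hφR
    π hT Q hrep Mf hM₀ hdomF hloc hdi hS hc hWm hWb hκ₁ hS0 hSσ Jset hA hc0 hcg hε hE (by rw [hμ]; exact hdomA)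
    hσ hP hr0 hr1 hgeo
  rw [hμ, map_measureReal_apply (measurable_pi_apply 0) MeasurableSet.univ, Set.preimage_univ] at h
  exact h

end EndToEndMarginal

/-! ## §9  WEAKLY DEPENDENT INNOVATIONS (v4, append-only): Efron–Stein with a TENSORISATION CONSTANT

§7/§8 buy robustness with a DENSITY-RATIO slack (global, resp. felt-marginal).  A density ratio against the product
reference is the wrong currency as soon as the felt set is large: for a Gibbs tilt by `#F` weak linking terms of size
`s` each, the sup of the marginal density ratio is `e^{Θ(#F·s)}`, and `#F_b ≍ |C|N₀L^{4b}` grows with the level.  The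
dimension-free currency is the APPROXIMATE TENSORISATION OF VARIANCE: the true innovation law `Q` satisfies an
Efron–Stein-type inequality `Var_Q(G) ≤ C_T·½Σᵢ ∫∫ (G ξ − G (ξ with ξᵢ := y))² d(qᵢ ξ)(y) dQ(ξ)` with single-site
RESAMPLING KERNELS `qᵢ` (for a product law: `qᵢ ξ = πᵢ`, `C_T = 1`, §2; for a weakly dependent Gibbs law: `qᵢ ξ` the
single-site conditional law and `C_T = 1/(1 − α)` with `α` Dobrushin's interdependence ROW SUM — a per-site quantity,
free of `#F`, of the volume and of the depth; that implication is a published theorem of the Dobrushin-uniqueness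
literature and is NOT formalised here — the inequality `hES` is a DISPLAYED HYPOTHESIS, kept unfolded).  §9 proves: such an
inequality + single-innovation sensitivities with second moments under the resampling kernels ⇒ `oneStepVar ≤
C_T·½Σᵢcᵢ²Sᵢ`, and the end-to-end primitive form with slack `C_T`. -/

section TensorisedRep

variable {X : ℕ → Type*} [∀ n, MeasurableSpace (X n)]
variable {κ : (b : ℕ) → Kernel (Π i : Iic b, X i) (X (b + 1))} [∀ b, IsMarkovKernel (κ b)]
variable {ι : Type u} [Fintype ι] [DecidableEq ι] {E : ι → Type v} [∀ i, MeasurableSpace (E i)]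

/-! **THE HYPOTHESIS SHAPE `hES` (Efron–Stein-type inequality with a tensorisation constant).**  For a law `Q` on
the innovation space, single-site resampling kernels `qᵢ` and a constant `C`:
`∀ G bounded measurable, ∫ (G − ∫G dQ)² dQ ≤ C·½Σᵢ ∫ (∫ (G ξ − G (ξ with ξᵢ := y))² d(qᵢ ξ)(y)) dQ(ξ)`.
Product laws satisfy it with `qᵢ ξ = πᵢ`, `C = 1` (`efronStein_pi_const`); in the dictionary `Q` is the joint law of
the innovations of a step given the history, `qᵢ ξ` its single-innovation conditional law, and `C = C_T` the
approximate-tensorisation (Glauber spectral gap) constant of a weakly dependent law.  It is kept UNFOLDED as a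
displayed hypothesis (no definition hides it). -/

/-- [folklore] The exact product case of the hypothesis shape `hES`: `⊗ᵢπᵢ` satisfies the Efron–Stein inequality
with the constant resampling kernels `πᵢ` and tensorisation constant `1` (§2, from the tree's
`EfronSteinInequality_holds`). -/
theorem efronStein_pi_const (π : (i : ι) → Measure (E i)) [∀ i, IsProbabilityMeasure (π i)] :
    ∀ (G : ((i : ι) → E i) → ℝ) (B : ℝ), Measurable G → (∀ ξ, |G ξ| ≤ B) →
      ∫ ξ, (G ξ - ∫ ζ, G ζ ∂Measure.pi π) ^ 2 ∂Measure.pi π ≤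
        (1 : ℝ) * ((1 / 2 : ℝ) * ∑ i, ∫ ξ, (∫ y, (G ξ - G (Function.update ξ i y)) ^ 2
          ∂((Kernel.const ((j : ι) → E j) (π i)) ξ)) ∂Measure.pi π) := by
  intro G B hG hB
  rw [one_mul]
  simpa only [Kernel.const_apply] using integral_sq_sub_integral_le_efronStein π hG hB

/-- [folklore] **ONE-STEP INCOHERENCE FOR WEAKLY DEPENDENT INNOVATIONS.**  Let the step law at the history `h` be the
image `κ b h = Q.map T` of an innovation law `Q` satisfying the Efron–Stein inequality `hES` with resampling kernels
`qᵢ` and tensorisation constant `C_T` (`0 ≤ C_T`).  If replacing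
innovation `i` moves the next effective observable `g ξ = fiberMean κ (b+1) φ (succGlue b (h, T ξ))` by at most
`cᵢ·dᵢ(ξᵢ, y)` and the resampling second moments satisfy `∫ dᵢ(ξᵢ, y)² d(qᵢ ξ)(y) ≤ Sᵢ` for every `ξ`, then
`oneStepVar κ b φ h ≤ C_T·½Σᵢ cᵢ²·Sᵢ`.  No product structure and no density ratio: the slack is the tensorisation
constant. -/
theorem oneStepVar_le_of_rep_efronSteinWith (b : ℕ) {φ : (Π n, X n) → ℝ} (hφm : StronglyMeasurable φ)
    {R : ℝ} (hφR : ∀ x, |φ x| ≤ R) (h : Π i : Iic b, X i) {T : ((i : ι) → E i) → X (b + 1)} (hT : Measurable T)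
    (Q : Measure ((i : ι) → E i)) [IsProbabilityMeasure Q] (hrep : κ b h = Q.map T)
    (q : (i : ι) → Kernel ((j : ι) → E j) (E i)) {CT : ℝ} (hCT : 0 ≤ CT)
    (hES : ∀ (G : ((i : ι) → E i) → ℝ) (B : ℝ), Measurable G → (∀ ξ, |G ξ| ≤ B) →
      ∫ ξ, (G ξ - ∫ ζ, G ζ ∂Q) ^ 2 ∂Q ≤
        CT * ((1 / 2 : ℝ) * ∑ i, ∫ ξ, (∫ y, (G ξ - G (Function.update ξ i y)) ^ 2 ∂(q i ξ)) ∂Q))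
    {c : ι → ℝ} {d : (i : ι) → E i → E i → ℝ}
    (hdi : ∀ i ξ, Integrable (fun y => d i (ξ i) y ^ 2) (q i ξ)) {S : ι → ℝ}
    (hS : ∀ i ξ, ∫ y, d i (ξ i) y ^ 2 ∂(q i ξ) ≤ S i)
    (hc : ∀ i ξ y, |fiberMean κ (b + 1) φ (succGlue b (h, T ξ)) -
        fiberMean κ (b + 1) φ (succGlue b (h, T (Function.update ξ i y)))| ≤ c i * d i (ξ i) y) :
    oneStepVar κ b φ h ≤ CT * ((1 / 2 : ℝ) * ∑ i, c i ^ 2 * S i) := by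
  set g : X (b + 1) → ℝ := fun y => fiberMean κ (b + 1) φ (succGlue b (h, y)) with hg
  have hgm : StronglyMeasurable g :=
    (stronglyMeasurable_fiberMean _ hφm).comp_measurable (measurable_succGlue_mk b h)
  have hGm : Measurable (fun ξ => g (T ξ)) := hgm.measurable.comp hT
  have hGb : ∀ ξ, |g (T ξ)| ≤ R := fun ξ => abs_fiberMean_le _ hφm hφR _
  set a : ℝ := ∫ ζ, g (T ζ) ∂Q with ha
  -- step 1: one-step variance ≤ second moment about `a` under the step law = under Q
  have h1 : oneStepVar κ b φ h ≤ ∫ ξ, (g (T ξ) - a) ^ 2 ∂Q := by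
    have h1' := oneStepVar_le_integral_kernel_sq_sub_const (κ := κ) b hφm hφR h a
    rw [hrep, integral_map hT.aemeasurable] at h1'
    · exact h1'
    · exact ((hgm.measurable.sub measurable_const).pow_const 2).aestronglyMeasurable
  -- step 2: the tensorised Efron–Stein inequality of Q
  have h2 := hES (fun ξ => g (T ξ)) R hGm hGb
  -- step 3: each resampling term is at most cᵢ²·Sᵢ
  have h3 : ∀ i, ∫ ξ, (∫ y, (g (T ξ) - g (T (Function.update ξ i y))) ^ 2 ∂(q i ξ)) ∂Q ≤ c i ^ 2 * S i := by
    intro i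
    have hin : ∀ ξ, ∫ y, (g (T ξ) - g (T (Function.update ξ i y))) ^ 2 ∂(q i ξ) ≤ c i ^ 2 * S i := fun ξ => by
      calc ∫ y, (g (T ξ) - g (T (Function.update ξ i y))) ^ 2 ∂(q i ξ)
          ≤ ∫ y, c i ^ 2 * d i (ξ i) y ^ 2 ∂(q i ξ) := by
            refine integral_mono_of_nonneg (Filter.Eventually.of_forall fun y => sq_nonneg _)
              ((hdi i ξ).const_mul _) (Filter.Eventually.of_forall fun y => ?_)
            have := hc i ξ y
            calc (g (T ξ) - g (T (Function.update ξ i y))) ^ 2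
                = |g (T ξ) - g (T (Function.update ξ i y))| ^ 2 := (sq_abs _).symm
              _ ≤ (c i * d i (ξ i) y) ^ 2 := pow_le_pow_left₀ (abs_nonneg _) this 2
              _ = c i ^ 2 * d i (ξ i) y ^ 2 := by ring
        _ = c i ^ 2 * ∫ y, d i (ξ i) y ^ 2 ∂(q i ξ) := integral_const_mul _ _
        _ ≤ c i ^ 2 * S i := mul_le_mul_of_nonneg_left (hS i ξ) (sq_nonneg _)
    calc ∫ ξ, (∫ y, (g (T ξ) - g (T (Function.update ξ i y))) ^ 2 ∂(q i ξ)) ∂Q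
        ≤ ∫ _ξ, c i ^ 2 * S i ∂Q :=
          integral_mono_of_nonneg (Filter.Eventually.of_forall fun ξ => integral_nonneg fun y => sq_nonneg _)
            (integrable_const _) (Filter.Eventually.of_forall hin)
      _ = c i ^ 2 * S i := by simp
  calc oneStepVar κ b φ h ≤ ∫ ξ, (g (T ξ) - a) ^ 2 ∂Q := h1
    _ ≤ CT * ((1 / 2 : ℝ) * ∑ i, ∫ ξ, (∫ y, (g (T ξ) - g (T (Function.update ξ i y))) ^ 2 ∂(q i ξ)) ∂Q) := h2
    _ ≤ CT * ((1 / 2 : ℝ) * ∑ i, c i ^ 2 * S i) :=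
          mul_le_mul_of_nonneg_left (mul_le_mul_of_nonneg_left (Finset.sum_le_sum fun i _ => h3 i) (by norm_num)) hCT

end TensorisedRep

/-! ### §9(b)  MI-ES, END-TO-END PRIMITIVE FORM with a TENSORISATION CONSTANT -/

section EndToEndTensorised

variable {X : ℕ → Type*} [∀ n, MeasurableSpace (X n)]
variable {κ : (b : ℕ) → Kernel (Π i : Iic b, X i) (X (b + 1))} [∀ b, IsMarkovKernel (κ b)]

open scoped Classical in
/-- [folklore] **MI-ES, END-TO-END PRIMITIVE FORM, TENSORISATION SLACK (realised chain).**  Step laws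
`κ b h = (Q b h).map (T b h)` with innovation laws satisfying the Efron–Stein inequality `hES` (kernels `q b h i`, constant `C_T`) uniformly, graded
sensitivities on felt sets with geometric counts, resampling second moments `≤ S b i ≤ σ²` under the kernels
`q b h i`, product-dominated irregularity events ⇒
`∫ (φ − towerMean)² dμ ≤ C_T·½C²σ²·ν(X 0)·e^{(κ₁²−1)E}·P/(1−r)`. -/
theorem integral_sq_sub_towerMean_le_of_graded_geometric_efronSteinWith (ν : Measure (X 0)) [IsFiniteMeasure ν]
    (n : ℕ) {φ : (Π k, X k) → ℝ} (hφn : StronglyMeasurable[piLE (X := X) n] φ) {R : ℝ} (hφR : ∀ x, |φ x| ≤ R)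
    {ι : ℕ → Type u} [∀ b, Fintype (ι b)] [∀ b, DecidableEq (ι b)] {E : (b : ℕ) → ι b → Type v}
    [∀ b i, MeasurableSpace (E b i)]
    {T : (b : ℕ) → (Π i : Iic b, X i) → ((i : ι b) → E b i) → X (b + 1)} (hT : ∀ b h, Measurable (T b h))
    (Q : (b : ℕ) → (Π i : Iic b, X i) → Measure ((i : ι b) → E b i)) [∀ b h, IsProbabilityMeasure (Q b h)]
    (hrep : ∀ b < n, ∀ h, κ b h = (Q b h).map (T b h))
    (q : (b : ℕ) → (Π i : Iic b, X i) → (i : ι b) → Kernel ((j : ι b) → E b j) (E b i))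
    {CT : ℝ} (hCT : 0 ≤ CT)
    (hES : ∀ b < n, ∀ h, ∀ (G : ((i : ι b) → E b i) → ℝ) (B : ℝ), Measurable G → (∀ ξ, |G ξ| ≤ B) →
      ∫ ξ, (G ξ - ∫ ζ, G ζ ∂Q b h) ^ 2 ∂Q b h ≤
        CT * ((1 / 2 : ℝ) * ∑ i, ∫ ξ, (∫ y, (G ξ - G (Function.update ξ i y)) ^ 2 ∂(q b h i ξ)) ∂Q b h))
    {c : (b : ℕ) → (Π i : Iic b, X i) → ι b → ℝ} {d : (b : ℕ) → (i : ι b) → E b i → E b i → ℝ}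
    (hdi : ∀ b h i ξ, Integrable (fun y => d b i (ξ i) y ^ 2) (q b h i ξ)) {S : (b : ℕ) → ι b → ℝ}
    (hS : ∀ b h i ξ, ∫ y, d b i (ξ i) y ^ 2 ∂(q b h i ξ) ≤ S b i)
    (hc : ∀ b < n, ∀ h i ξ y, |fiberMean κ (b + 1) φ (succGlue b (h, T b h ξ)) -
        fiberMean κ (b + 1) φ (succGlue b (h, T b h (Function.update ξ i y)))| ≤ c b h i * d b i (ξ i) y)
    (hWm : ∀ b, StronglyMeasurable (fun h => ∑ i, c b h i ^ 2 * S b i)) {CW : ℝ}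
    (hWb : ∀ b h, |∑ i, c b h i ^ 2 * S b i| ≤ CW)
    (Mf : (b : ℕ) → Finset (ι b)) {C σsq κ₁ Etot : ℝ} (hκ₁ : 1 ≤ κ₁) {Θ : ℕ → ℝ}
    (hS0 : ∀ b i, 0 ≤ S b i) (hSσ : ∀ b i, S b i ≤ σsq)
    {J : ℕ → Type*} (Jset : (b : ℕ) → ι b → Finset (J b)) {A : (b : ℕ) → ι b → J b → Set (Π i : Iic b, X i)}
    (hA : ∀ b < n, ∀ i ∈ Mf b, ∀ j ∈ Jset b i, MeasurableSet (A b i j))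
    (hc0 : ∀ b < n, ∀ h, ∀ i ∉ Mf b, c b h i = 0)
    (hcg : ∀ b < n, ∀ h, ∀ i ∈ Mf b, |c b h i| ≤ C * Θ b * κ₁ ^ ((Jset b i).filter fun j => h ∈ A b i j).card)
    {ε : (b : ℕ) → ι b → J b → ℝ} (hε : ∀ b < n, ∀ i ∈ Mf b, ∀ j ∈ Jset b i, 0 ≤ ε b i j)
    (hE : ∀ b < n, ∀ i ∈ Mf b, ∑ j ∈ Jset b i, ε b i j ≤ Etot)
    (hdomA : ∀ b < n, ∀ i ∈ Mf b, ∀ S' ⊆ Jset b i,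
      (Kernel.trajMeasure ν κ).real (⋂ j ∈ S', {x | frestrictLe b x ∈ A b i j}) ≤
        (Kernel.trajMeasure ν κ).real Set.univ * ∏ j ∈ S', ε b i j)
    (hσ : 0 ≤ σsq) {P r : ℝ} (hP : 0 ≤ P) (hr0 : 0 ≤ r) (hr1 : r < 1)
    (hgeo : ∀ b, ((Mf b).card : ℝ) * Θ b ^ 2 ≤ P * r ^ b) :
    ∫ x, (φ x - towerMean κ φ (x 0)) ^ 2 ∂(Kernel.trajMeasure ν κ) ≤
      CT * ((1 / 2 : ℝ) * (C ^ 2 * σsq) * (ν.real Set.univ * Real.exp ((κ₁ ^ 2 - 1) * Etot)) *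
        (P / (1 - r))) := by
  have hφm : StronglyMeasurable φ := hφn.mono ((piLE (X := X)).le n)
  exact integral_sq_sub_towerMean_le_of_stepBudget_graded_geometric (κ := κ) ν n hφn hφR hCT
    (fun b hb h => oneStepVar_le_of_rep_efronSteinWith b hφm hφR h (hT b h) (Q b h) (hrep b hb h) (q b h) hCT
      (hES b hb h) (hdi b h) (hS b h) (hc b hb h))
    hWm hWb Mf hκ₁ hS0 hSσ Jset hA hc0 hcg hε hE hdomA hσ hP hr0 hr1 hgeo

open scoped Classical in
/-- [folklore] **MI-ES, END-TO-END PRIMITIVE FORM, TENSORISATION SLACK — arbitrary path law, any kernel version.** -/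
theorem integral_sq_sub_towerMean_le_of_graded_geometric_efronSteinWith_pathLaw (μ : Measure (Π n, X n))
    [IsFiniteMeasure μ] (κ' : (b : ℕ) → Kernel (Π i : Iic b, X i) (X (b + 1))) [∀ b, IsMarkovKernel (κ' b)]
    (hκ' : ∀ b, μ.map (frestrictLe b) ⊗ₘ κ' b = μ.map (fun x => (frestrictLe b x, x (b + 1)))) (n : ℕ)
    {φ : (Π k, X k) → ℝ} (hφn : StronglyMeasurable[piLE (X := X) n] φ) {R : ℝ} (hφR : ∀ x, |φ x| ≤ R)
    {ι : ℕ → Type u} [∀ b, Fintype (ι b)] [∀ b, DecidableEq (ι b)] {E : (b : ℕ) → ι b → Type v}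
    [∀ b i, MeasurableSpace (E b i)]
    {T : (b : ℕ) → (Π i : Iic b, X i) → ((i : ι b) → E b i) → X (b + 1)} (hT : ∀ b h, Measurable (T b h))
    (Q : (b : ℕ) → (Π i : Iic b, X i) → Measure ((i : ι b) → E b i)) [∀ b h, IsProbabilityMeasure (Q b h)]
    (hrep : ∀ b < n, ∀ h, κ' b h = (Q b h).map (T b h))
    (q : (b : ℕ) → (Π i : Iic b, X i) → (i : ι b) → Kernel ((j : ι b) → E b j) (E b i))
    {CT : ℝ} (hCT : 0 ≤ CT)
    (hES : ∀ b < n, ∀ h, ∀ (G : ((i : ι b) → E b i) → ℝ) (B : ℝ), Measurable G → (∀ ξ, |G ξ| ≤ B) →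
      ∫ ξ, (G ξ - ∫ ζ, G ζ ∂Q b h) ^ 2 ∂Q b h ≤
        CT * ((1 / 2 : ℝ) * ∑ i, ∫ ξ, (∫ y, (G ξ - G (Function.update ξ i y)) ^ 2 ∂(q b h i ξ)) ∂Q b h))
    {c : (b : ℕ) → (Π i : Iic b, X i) → ι b → ℝ} {d : (b : ℕ) → (i : ι b) → E b i → E b i → ℝ}
    (hdi : ∀ b h i ξ, Integrable (fun y => d b i (ξ i) y ^ 2) (q b h i ξ)) {S : (b : ℕ) → ι b → ℝ}
    (hS : ∀ b h i ξ, ∫ y, d b i (ξ i) y ^ 2 ∂(q b h i ξ) ≤ S b i)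
    (hc : ∀ b < n, ∀ h i ξ y, |fiberMean κ' (b + 1) φ (succGlue b (h, T b h ξ)) -
        fiberMean κ' (b + 1) φ (succGlue b (h, T b h (Function.update ξ i y)))| ≤ c b h i * d b i (ξ i) y)
    (hWm : ∀ b, StronglyMeasurable (fun h => ∑ i, c b h i ^ 2 * S b i)) {CW : ℝ}
    (hWb : ∀ b h, |∑ i, c b h i ^ 2 * S b i| ≤ CW)
    (Mf : (b : ℕ) → Finset (ι b)) {C σsq κ₁ Etot : ℝ} (hκ₁ : 1 ≤ κ₁) {Θ : ℕ → ℝ}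
    (hS0 : ∀ b i, 0 ≤ S b i) (hSσ : ∀ b i, S b i ≤ σsq)
    {J : ℕ → Type*} (Jset : (b : ℕ) → ι b → Finset (J b)) {A : (b : ℕ) → ι b → J b → Set (Π i : Iic b, X i)}
    (hA : ∀ b < n, ∀ i ∈ Mf b, ∀ j ∈ Jset b i, MeasurableSet (A b i j))
    (hc0 : ∀ b < n, ∀ h, ∀ i ∉ Mf b, c b h i = 0)
    (hcg : ∀ b < n, ∀ h, ∀ i ∈ Mf b, |c b h i| ≤ C * Θ b * κ₁ ^ ((Jset b i).filter fun j => h ∈ A b i j).card)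
    {ε : (b : ℕ) → ι b → J b → ℝ} (hε : ∀ b < n, ∀ i ∈ Mf b, ∀ j ∈ Jset b i, 0 ≤ ε b i j)
    (hE : ∀ b < n, ∀ i ∈ Mf b, ∑ j ∈ Jset b i, ε b i j ≤ Etot)
    (hdomA : ∀ b < n, ∀ i ∈ Mf b, ∀ S' ⊆ Jset b i,
      μ.real (⋂ j ∈ S', {x | frestrictLe b x ∈ A b i j}) ≤ μ.real Set.univ * ∏ j ∈ S', ε b i j)
    (hσ : 0 ≤ σsq) {P r : ℝ} (hP : 0 ≤ P) (hr0 : 0 ≤ r) (hr1 : r < 1)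
    (hgeo : ∀ b, ((Mf b).card : ℝ) * Θ b ^ 2 ≤ P * r ^ b) :
    ∫ x, (φ x - towerMean κ' φ (x 0)) ^ 2 ∂μ ≤
      CT * ((1 / 2 : ℝ) * (C ^ 2 * σsq) * (μ.real Set.univ * Real.exp ((κ₁ ^ 2 - 1) * Etot)) *
        (P / (1 - r))) := by
  have hμ := trajMeasure_eq_of_compProd μ κ' hκ'
  have h := integral_sq_sub_towerMean_le_of_graded_geometric_efronSteinWith (κ := κ') (μ.map (fun x => x 0)) n
    hφn hφR hT Q hrep q hCT hES hdi hS hc hWm hWb Mf hκ₁ hS0 hSσ Jset hA hc0 hcg hε hE (by rw [hμ]; exact hdomA)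
    hσ hP hr0 hr1 hgeo
  rw [hμ, map_measureReal_apply (measurable_pi_apply 0) MeasurableSet.univ, Set.preimage_univ] at h
  exact h

end EndToEndTensorised

end Literature.MathematicalPhysics.QuantumFieldTheory.Balaban1983to89.T4CouplingIncoherence
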